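import Mathlib.Analysis.SpecialFunctions.Trigonometric.Chebyshev.Basic
import Mathlib.Analysis.Polynomial.Basic
import Mathlib.Algebra.Polynomial.Inductions
import Mathlib.Algebra.Polynomial.Roots
import Mathlib.Analysis.Complex.Polynomial.Basic
import Literature.Analysis.Approximation.ChebyshevShiftedMinimax
import Literature.MathematicalPhysics.QuantumLattice.TwistedMassWilson
import Literature.MathematicalPhysics.QuantumFieldTheory.PseudofermionIntegral
import HarnessLib

/-!
# The Chebyshev polynomial `P_{n,ε}(s) ≈ 1/s` of the multiboson and PHMC algorithms: explicit roots on
# an ellipse, Lüscher's positive factorisation `P(Q²) = c_n ∏ₖ [(Q − μ_k)² + ν_k²]`, the bosonic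
# (Gaussian) representation of `1/det P(Q²)`, and the exact correction factor `W = det[Q² P(Q²)]`

Topic `MathematicalPhysics/QuantumFieldTheory`, next to `Multiboson.lean` (Lüscher's multiboson WEIGHT on
gauge fields for the route `MultibosonBridge`, whose docstring lists as NOT there: Lüscher's (3.4)–(3.6),
the explicit roots, and the Gaussian identity) and to `PseudofermionIntegral.lean`; it reuses the tree's
shifted Chebyshev polynomial `Literature/Analysis/Approximation/ChebyshevShiftedMinimax` (Saad's `Ĉ_k`
with the `√κ` rate), the discharged complex Gaussian integral
`Literature.Analysis.SpecialFunctions.complexGaussianIntegral_posDef_holds` (Altland–Simons (3.17)),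
the Hermitian-matrix function lemmas of `QuantumLattice/RationalHybridMonteCarlo` (`RHMC.det_cfc`), the
Lüscher–Palombi one-noise estimator of `QuantumLattice/TwistedMassDeterminant`
(`TwistedMass.integral_rwEstimator`) and the Knechtli–Wolff ratio estimator of `PseudofermionIntegral`
(`Pseudofermion.stochasticRatio_mean`).  PUBLISHED RESULTS formalised, for ONE Hermitian (or arbitrary
square complex) matrix `Q` at a time — in the sources `Q = c·γ₅(D_W + m)` on a fixed gauge field, and §6
instantiates everything for the tree's Wilson–Dirac operator `wilsonDirac ρ U m r` on EVERY gauge field: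

* M. Lüscher, Nucl. Phys. B 418 (1994) 637 = hep-lat/9311007 [Luscher1994] (equation numbers as
  printed): §2 (2.6)–(2.8) "`[γ₅(D+m)]† = γ₅(D+m)` … the quark determinant `det(D+m)` is real …
  `Q = γ₅(D+m)/M` which has eigenvalues between −1 and 1"; §3 (3.3) "`det Q² = lim_{n→∞}[det P(Q²)]⁻¹`",
  (3.4) the roots of the simple polynomial, "For even `n` they come in complex conjugate pairs with
  non-zero imaginary parts. The polynomial may then be written in the manifestly positive form (3.5)
  `P(Q²) = ∏_{k=1}^{n} [(Q − μ_k)² + ν_k²]`, where … (3.6) `μ_k + iν_k = √z_k`, `ν_k > 0`. Every value of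
  `ν_k` occurs twice and the corresponding `μ_k`'s have equal magnitude and opposite sign", (3.7)–(3.9)
  the bosonic action `S_b = S_g + Σ_x Σ_k {|(Q − μ_k)φ_k(x)|² + ν_k²|φ_k(x)|²}` and "`P_eff[U] =
  lim 1/Z_b ∫ D[φ]D[φ†] e^{−S_b[U,φ]}` … the action is local and non-negative. In particular, the Gaussian
  integrals in eq. (3.8) are well-defined … One only requires that eq. (3.2) holds and that none of the
  roots `z_k` of the polynomial are real"; §4.3 (4.16) "`cosh β = (1+ε)/(1−ε)`", (4.17)
  "`P(s) = [1 + R(s)]/s`"; §4.5 "The polynomial `P(s)` can then be shown to be positive for all `s` and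
  its roots thus come in complex conjugate pairs", (4.32) "the roots tend to lie on an ellipse".
  (Lüscher's own 1994 polynomial is `R = α[T*_{n+1}/(n+1) − T*_{n−1}/(n−1)]` (4.13), whose roots have no
  closed form; the plain Chebyshev polynomial below — "somewhat simpler than the polynomial proposed in
  ref. [1], but so far seems to do equally well in practice" — is the one of his collaboration's
  follow-up and of all later multiboson / PHMC work.)
* B. Bunk, K. Jansen, B. Jegerlehner, M. Lüscher, H. Simma, R. Sommer, Nucl. Phys. B (Proc. Suppl.) 42
  (1995) 49 = hep-lat/9411016 [BunkEtAl1995] (numbers as printed): §2 (8) "`P(Q²) = constant ×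
  ∏ₖ[(Q − μ_k)² + ν_k²]`", (9) "`μ_k + iν_k = √z_k`, `ν_k > 0`", (10) "`det[(Q − μ_k)² + ν_k²]⁻¹` can be
  represented as a Gaussian integral over some auxiliary bosonic field `φ_k`", (11)–(12) `P_eff`, `S_b`;
  §3 "CHOICE OF `P(s)`": (13) "`u = (s − ε)/(1 − ε)`, `cos θ = 2u − 1`", (14) "`T*_r(u) = cos(rθ)`",
  (15) "`P(s) = [1 + ρT*_{n+1}(u)]/s` where the constant `ρ` is chosen such that the square bracket vanishes
  at `s = 0` (and so is divisible by `s`)", (16) "`R(s) = [P(s) − 1/s]s`", (17) "`|R(s)| ≤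
  2((1−√ε)/(1+√ε))^{n+1}`, i.e. the convergence is exponential with a rate roughly equal to `2√ε`", (18)
  "`z_k = ½(1+ε) − ½(1+ε)cos(2πk/(n+1)) − i√ε sin(2πk/(n+1))` (`k = 1, …, n`). They lie on an ellipse around
  the spectral interval `0 ≤ s ≤ 1` and satisfy `Im z_k ≠ 0` (recall that `n` is assumed to be even)".
* A. Boriçi, Ph. de Forcrand, Nucl. Phys. B 454 (1995) 645 = hep-lat/9505021 [BoriciDeforcrand1995]
  (equation numbers COUNTED in the arXiv TeX source, where every display is a numbered `equation`; the
  count is confirmed by the paper's own references to its eqs. (17) and (20) in §4): §2 (1) "`P(x) ≡ c_n x^n +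
  … + c_0 = c_n ∏_{k=1}^{n}(x − z_k)`", (2) "`det P(Q²) = c_n^N ∏_{k=1}^{n} det(Q − √z̄_k) det(Q − √z_k)`",
  (3) "`det Q² ≈ 1/det P(Q²) = … ∫∏ₖ[dφ_k†][dφ_k] e^{−φ_k†(Q − √z_k)†(Q − √z_k)φ_k}`", (4)–(5) `D = 1 − κM`,
  `Q = c₀γ₅D`, (9) "`P(x) = (1 − R(x))/x = c_n∏(x − z_k)`", (10) "`R(x) = T_{n+1}(2x/(1−ε) −
  (1+ε)/(1−ε))/T_{n+1}(−(1+ε)/(1−ε))`" ("scaled and translated Chebyshev polynomial such that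
  `R(0) = 1`"), (11) the roots `z_k` ("By straightforward algebra, one verifies …"), (12) "`|R(x)| =
  |1 − xP(x)| ≤ 2((1−√ε)/(1+√ε))^{n+1}` ∀`x ∈ [ε,1]`", (13)–(14) "`y ≡ det Q²P(Q²) = ∏ᵢ λᵢP(λᵢ)`"; §3 (16)
  "`c_n⁻¹ = ((1+ε)/2)∏((1+ε)/2 − z_k)`" (from "`R((1+ε)/2) = 0`"); §5.1 (26)–(34) the ellipses
  `cos(θ₁ + iθ₂)` and "`|R(z)| ≤ cosh((n+1)θ₂)/cosh((n+1)α)`"; §6 (37) "`⟨e^{−η†(W†W − 1)η}⟩` …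
  `W = [D'P(D')]⁻¹DP(D)`. It is sufficient to estimate this ratio by taking one Gaussian `η` only … a
  modest increase `∝ Log V` in `n`" — "a simple Metropolis test which makes the algorithm exact".
* R. Frezzotti, K. Jansen, Phys. Lett. B 402 (1997) 328 = hep-lat/9702016 [FrezzottiJansen1997] (the PHMC
  algorithm; numbers COUNTED in the arXiv source, labels `pf`=(1), (4), (5), `newpf`=(6),
  `correction`=(7), `observable`=(8), `factorize`=(9), (10)–(13)): (4)–(5) "`det[Q²P_n(Q²)] → 1` for
  `n → ∞`, with `P_n(λ(Q²)) > 0` … Then we can rewrite the determinant `det(Q²) =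
  det[Q²P_n(Q²)]/det[P_n(Q²)]`", (6)–(7) "`Z = ∫DU Dφ†Dφ Dη†Dη W exp{−S_g − φ†P_n(Q²)φ − η†η}` where we
  introduced the 'correction factor' `W = exp{η†(1 − [Q²P_n(Q²)]⁻¹)η}`. Note that eq. (newpf) is an
  exact rewriting of the partition function", (8) "`⟨O⟩ = ⟨OW⟩_P/⟨W⟩_P` … Alternatively one may
  incorporate the `W` factor via a reject/accept step", (9) "`P_{[n,ε]}(Q²) = c_N∏ₖ[Q² − z_k] =
  c_N∏ₖ[(Q − √z_k*)(Q − √z_k)]`", (10) the roots, (11)–(13) "`R_{[n,ε]}(s) = [P(s) − 1/s]s` …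
  `|R| ≤ 2((1−√ε)/(1+√ε))^{n+1}` … `δ = 2((1−√ε)/(1+√ε))^{n+1}`", and "For `0 ≤ s ≤ ε` the polynomial … is
  always finite with values `O(1/ε)` … one might choose `ε > λ_min(Q²)`".

## Contents (all proved; no named fact is introduced — D-0026)

* §1 `delta ε n = 2((1−√ε)/(1+√ε))^{n+1}`, `errPoly ε n = R` (the tree's `shiftedChebyshev ε 1 (n+1)`),
  `invPoly ε n = P = (1 − R)/X` (`Polynomial.divX`): `errPoly_eval_zero` (`R(0) = 1`), `X_mul_invPoly`,
  `mul_eval_invPoly` (`sP(s) = 1 − R(s)`), `abs_errPoly_le_delta` / `abs_one_sub_mul_eval_invPoly_le` /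
  `mul_eval_invPoly_mem_Icc` (the bound (12)/(17)/(12)–(13)), `delta_le_of_count` (the `½ε^{−1/2}ln(2/δ)`
  count), `natDegree_errPoly = n + 1`, `natDegree_invPoly = n`.
* §2 `root ε n k = z_k`, `angle n k = 2πk/(n+1)`: `root_mem_ellipse`, `conj_root` (`z̄_k = z_{n+1−k}`),
  `root_ne_zero`, `root_im_ne_zero` (even `n`), `root_injOn`; `beta ε = log((1+√ε)/(1−√ε))` with
  `cosh_beta`, `sinh_beta` ((4.16)), `eval_T_eq_cosh`, `abs_errPoly_le_inv_cosh` (the sharp bound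
  `1/cosh((n+1)β)`), `mul_eval_invPoly_pos_of_mem`; **`aeval_root_errPoly`** (`R(z_k) = 1`, via
  `(1+ε)/(1−ε) − 2z_k/(1−ε) = cos(θ_k − iβ)` and `T_{n+1}(cos w) = cos((n+1)w)`), **`isRoot_invPoly_root`**,
  **`map_invPoly_eq_prod`** (`P = c_n∏_{k=1}^{n}(X − z_k)` in `ℂ[X]`), `eval_invPoly_pos` (`P > 0` on `ℝ`,
  even `n`), `leadingCoeff_invPoly_pos` (`c_n > 0`), `mid_mul_eval_invPoly` /
  `leadingCoeff_mul_prod_mid_sub_root` (Boriçi–de Forcrand's (16)).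
* §3 `usqrt z` (the square root with `Im ≥ 0`: Lüscher's branch): `usqrt_sq`, `usqrt_im`
  (`= √((|z|−Re z)/2)`), `abs_usqrt_re`, `usqrt_im_pos`, `usqrt_eq_of_sq_eq` (uniqueness), **`usqrt_conj`**
  (`√z̄ = −conj √z`); `rootMu`/`rootNu` (`μ_k`, `ν_k`) with `rootNu_pos`, `rootNu_rev` (`ν_{n+1−k} = ν_k`),
  `rootMu_rev` (`μ_{n+1−k} = −μ_k`); **`prod_quad_eq_prod_sq_sub`** (the pairing identity in `ℂ[X]` for ANY
  root family closed under `w ↦ −w̄`) and **`map_invPoly_comp_X_sq`** ((3.5): `P(X²) =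
  c_n∏ₖ[(X − μ_k)² + ν_k²]`).
* §4 `quadFactor Q μ ν = (Q − μ)² + ν²`: for Hermitian `Q`, `quadFactor_eq_conjTranspose_mul`
  (`= (Q − w)†(Q − w)`), `re_quadForm_quadFactor`, `posDef_quadFactor`, `det_quadFactor`
  (`= |det(Q − μ − iν)|²`), **`integral_exp_neg_quadForm_quadFactor`** ((10)/(3)/(3.8): one root = one
  Gaussian boson field); for any `Q`, **`det_aeval_invPoly`** (`det P(Q²) = c_n^N∏ₖdet[(Q−μ_k)²+ν_k²]`);
  for Hermitian `Q`, `det_aeval_invPoly_pos` and **`inv_det_aeval_invPoly_eq_prod_integral`**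
  (`1/det P(Q²) = c_n^{−N}∏ₖ π^{−N}∫exp(−φ_k†[(Q−μ_k)²+ν_k²]φ_k)dφ_k`).
* §5 `corrFactor ε n Q = W = det[Q²P(Q²)]`: `det_mul_self_eq_corrFactor_div` ((5)),
  `corrFactor_eq_zero_of_det_eq_zero` (zero modes), `mul_self_mul_aeval_eq_cfc`,
  `corrFactor_eq_prod_eigenvalues` ((14): `W = ∏ᵢλᵢP(λᵢ)`), `corrFactor_eq_prod_one_sub`, `corrFactor_im`,
  `mul_eval_invPoly_lt_one` (modes below `ε` are damped), bounds `corrFactor_re_pos_of_spectrum`,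
  `corrFactor_re_le_of_spectrum` / `pow_le_corrFactor_re_of_spectrum` (`(1−δ)^N ≤ W ≤ (1+δ)^N` on the fit
  range), `corrFactor_re_nonneg` / `corrFactor_re_le` (`0 ≤ W ≤ (1+δ)^N` whenever `‖Q‖ ≤ 1`, even `n`),
  **`integral_corrEstimator`** ((6)–(7): FJ's `W` is an unbiased one-noise Gaussian estimator of
  `det[Q²P(Q²)]`), `bdf_noisy_ratio` (Boriçi–de Forcrand's (37)).
* §6 `wilsonQ ρ U m r c = c·Γ₅·wilsonDirac ρ U m r`: `isHermitian_wilsonQ`,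
  `det_aeval_invPoly_wilsonQ_pos`, `inv_det_aeval_invPoly_wilsonQ`, `corrFactor_wilsonQ_mem_Icc`,
  `corrFactor_wilsonQ_mem_Icc_of_spectrum` — the statements of §4–§5 on every gauge field `U`, any gauge
  group, any unitary colour representation, any `L ≥ 1`, `m`, `r`, `c`.

A point the formalisation pins down: Boriçi–de Forcrand's (2) and Frezzotti–Jansen's (9) write the
factors as `(Q − √z̄_k)(Q − √z_k)`; read with PRINCIPAL square roots this is not a factor-by-factor
identity (the set `{√z_k}` must be closed under `w ↦ −w̄`), and it is Lüscher's branch `ν_k > 0` of (3.6)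
— `usqrt`, with `√z̄ = −conj √z` — that makes `∏ₖ(X − √z_k)(X − conj √z_k) = ∏ₖ(X² − z_k)` true
(`prod_quad_eq_prod_sq_sub`).

HONEST SCOPE.  One matrix at a time: nothing about Markov chains, heat-bath/over-relaxation updates of
the `φ_k`, autocorrelations, forces, even–odd preconditioning (Boriçi–de Forcrand §4 is the tree's
`EvenOddPreconditioning.lean`), the non-Hermitian variant (their §5, approximating `1/D`), or the
`n → ∞` limit (3.3) as a limit statement (what is proved is the finite-`n` identity `det Q² =
W/det P(Q²)` with the explicit two-sided bounds on `W`); the spectral hypotheses "`spectrum(Q²) ⊆ [ε,1]`"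
/ "`⊆ [0,1]`" are hypotheses on the normalisation `c`, as in the sources.  Cell pub-lqcd (venture
`LatticeQCDFlow`), HOME/R2-SCOPE.md §3 E2 ("polynomial/rational … with its own exact correction"), §3 E4 /
§5 X-5c ("a truncated polynomial … approximation left in the accept step changes the target" — by
exactly `W(U)`), §4 (cost in boson fields / solver terms `n + 1 ≍ ½ε^{−1/2}ln(2/δ)`), FANOUT row 38.

## References
* [Luscher1994] M. Lüscher, Nucl. Phys. B 418 (1994) 637, §2 (2.6)–(2.8), §3 (3.3)–(3.9), §4.3
  (4.16)–(4.17), §4.5 (4.32).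
* [BunkEtAl1995] B. Bunk, K. Jansen, B. Jegerlehner, M. Lüscher, H. Simma, R. Sommer, Nucl. Phys. B (Proc.
  Suppl.) 42 (1995) 49, §2 (8)–(12), §3 (13)–(18).
* [BoriciDeforcrand1995] A. Boriçi, Ph. de Forcrand, Nucl. Phys. B 454 (1995) 645, §2 (1)–(5), (9)–(14),
  §3 (16), §5.1 (26)–(34), §6 (37).
* [FrezzottiJansen1997] R. Frezzotti, K. Jansen, Phys. Lett. B 402 (1997) 328, eqs. (3)–(13).
* [Saad2003] Y. Saad, Iterative Methods for Sparse Linear Systems, 2nd ed., §6.11 (through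
  `ChebyshevShiftedMinimax`).
* [AltlandSimons2010] A. Altland, B. Simons, Condensed Matter Field Theory, §3.2 (3.17) (through
  `ComplexGaussianDeterminant`).
* [LuscherPalombi2008] M. Lüscher, F. Palombi, PoS(LATTICE 2008)049, (6.1)–(6.2) (through
  `TwistedMassDeterminant`).
* [KnechtliWolff2003] F. Knechtli, U. Wolff, Nucl. Phys. B 663 (2003) 3, (4.5) (through
  `PseudofermionIntegral`).
-/

noncomputable section

open Polynomial Real Set
open Literature.Analysis.Approximation.ChebyshevShifted

namespace Literature.MathematicalPhysics.QuantumFieldTheory.MultibosonPolynomial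

/-! ## §1 The polynomial `P_{n,ε}`, its error polynomial `R_{n,ε}` and the accuracy `δ` -/

section Polynomial

variable {ε : ℝ} {n : ℕ}

/-- The accuracy parameter `δ = 2 ((1 − √ε)/(1 + √ε))^{n+1}` of the degree-`n` Chebyshev approximation
of `1/s` on `[ε, 1]` ("an upper bound to the maximum relative error of the polynomial approximation").
[cite: FrezzottiJansen1997, eq. (13) (δ), arXiv TeX count] [cite: BunkEtAl1995, §3 eq. (17)]
[cite: BoriciDeforcrand1995, §2 eq. (12)] -/
def delta (ε : ℝ) (n : ℕ) : ℝ := 2 * ((1 - Real.sqrt ε) / (1 + Real.sqrt ε)) ^ (n + 1)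

/-- The error polynomial `R(s) = T_{n+1}((1 + ε − 2s)/(1 − ε)) / T_{n+1}((1 + ε)/(1 − ε))` — "the scaled
and translated Chebyshev polynomial such that `R(0) = 1`" (Boriçi–de Forcrand (10):
`R(x) = T_{n+1}(2x/(1−ε) − (1+ε)/(1−ε)) / T_{n+1}(−(1+ε)/(1−ε))`, the same ratio since
`T_{n+1}(−y) = (−1)^{n+1}T_{n+1}(y)`); it is the tree's shifted Chebyshev polynomial `Ĉ_{n+1}` of the
interval `[ε, 1]` (Saad's (6.113), `Literature/Analysis/Approximation/ChebyshevShiftedMinimax`).  Sign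
conventions: Bunk et al. (16) and Frezzotti–Jansen (11) call `R_{n,ε}(s) = [P(s) − 1/s]·s = −R(s)` the
relative fit error. [cite: BoriciDeforcrand1995, §2 eq. (10)] [cite: BunkEtAl1995, §3 eqs. (13)–(16)] -/
def errPoly (ε : ℝ) (n : ℕ) : ℝ[X] := shiftedChebyshev ε 1 (n + 1)

/-- **The approximation polynomial `P_{n,ε}` of degree `n`**: `P(s) = [1 − R(s)]/s` — "the constant … is
chosen such that the square bracket vanishes at `s = 0` (and so is divisible by `s`)"
(Bunk et al. (15); Boriçi–de Forcrand (9) `P(x) = (1 − R(x))/x`; Lüscher 1994 (4.17) has the same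
shape `P(s) = [1 + R(s)]/s` for his polynomial).  Realised with Mathlib's `Polynomial.divX`.
[cite: BunkEtAl1995, §3 eq. (15)] [cite: BoriciDeforcrand1995, §2 eq. (9)] [cite: Luscher1994, §4.3 eq. (4.17)] -/
def invPoly (ε : ℝ) (n : ℕ) : ℝ[X] := Polynomial.divX (1 - errPoly ε n)

/-- Unfolding `δ`. [cite: FrezzottiJansen1997, eq. (13)] -/
theorem delta_def (ε : ℝ) (n : ℕ) :
    delta ε n = 2 * ((1 - Real.sqrt ε) / (1 + Real.sqrt ε)) ^ (n + 1) := rfl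

/-- `δ > 0` for `0 < ε < 1`. [cite: FrezzottiJansen1997, eq. (13)] -/
theorem delta_pos (hε : 0 < ε) (hε1 : ε < 1) (n : ℕ) : 0 < delta ε n := by
  have hs1 : Real.sqrt ε < 1 := by
    rw [show (1 : ℝ) = Real.sqrt 1 by simp]
    exact Real.sqrt_lt_sqrt hε.le hε1
  have hs0 : 0 < Real.sqrt ε := Real.sqrt_pos.mpr hε
  unfold delta
  exact mul_pos two_pos (pow_pos (div_pos (by linarith) (by linarith)) _)

/-- Evaluation of `R`: `R(s) = T_{n+1}((1+ε)/(1−ε) − 2s/(1−ε)) / T_{n+1}((1+ε)/(1−ε))`.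
[cite: BoriciDeforcrand1995, §2 eq. (10)] -/
theorem eval_errPoly (ε : ℝ) (n : ℕ) (s : ℝ) :
    (errPoly ε n).eval s =
      ((Chebyshev.T ℝ (n + 1 : ℕ)).eval ((1 + ε) / (1 - ε)))⁻¹ *
        (Chebyshev.T ℝ (n + 1 : ℕ)).eval ((1 + ε) / (1 - ε) - 2 / (1 - ε) * s) := by
  rw [errPoly, eval_shiftedChebyshev]

/-- `R(0) = 1` (the normalisation that makes `1 − R` divisible by `s`).
[cite: BoriciDeforcrand1995, §2 (after eq. (9): "such that `R(0) = 1`")] [cite: BunkEtAl1995, §3 (after (15))] -/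
theorem errPoly_eval_zero (hε : 0 < ε) (hε1 : ε < 1) (n : ℕ) : (errPoly ε n).eval 0 = 1 :=
  eval_zero_shiftedChebyshev hε hε1 (n + 1)

/-- **Divisibility**: `s · P(s) = 1 − R(s)` as polynomials, `X · P = 1 − R`.
[cite: BunkEtAl1995, §3 eq. (15)] [cite: BoriciDeforcrand1995, §2 eq. (9)] -/
theorem X_mul_invPoly (hε : 0 < ε) (hε1 : ε < 1) (n : ℕ) :
    X * invPoly ε n = 1 - errPoly ε n := by
  have h0 : (1 - errPoly ε n).coeff 0 = 0 := by
    rw [coeff_zero_eq_eval_zero, eval_sub, eval_one, errPoly_eval_zero hε hε1, sub_self]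
  have h := X_mul_divX_add (1 - errPoly ε n)
  rwa [h0, map_zero, add_zero] at h

/-- `s P(s) = 1 − R(s)` at every real `s`. [cite: BunkEtAl1995, §3 eqs. (15)–(16)] -/
theorem mul_eval_invPoly (hε : 0 < ε) (hε1 : ε < 1) (n : ℕ) (s : ℝ) :
    s * (invPoly ε n).eval s = 1 - (errPoly ε n).eval s := by
  have h := congrArg (fun p : ℝ[X] => p.eval s) (X_mul_invPoly hε hε1 n)
  simpa only [eval_mul, eval_X, eval_sub, eval_one] using h

/-- `P(s) = (1 − R(s))/s` for `s ≠ 0`. [cite: BoriciDeforcrand1995, §2 eq. (9)] -/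
theorem eval_invPoly_of_ne_zero (hε : 0 < ε) (hε1 : ε < 1) (n : ℕ) {s : ℝ} (hs : s ≠ 0) :
    (invPoly ε n).eval s = (1 - (errPoly ε n).eval s) / s := by
  rw [← mul_eval_invPoly hε hε1 n s, mul_div_cancel_left₀ _ hs]

/-- The geometric ratio of the tree's `√κ`-rate at `κ = 1/ε` is `(1 − √ε)/(1 + √ε)` (private helper).
[folklore] -/
private theorem ratio_sqrt_inv_eq (hε : 0 < ε) :
    (Real.sqrt (1 / ε) - 1) / (Real.sqrt (1 / ε) + 1) = (1 - Real.sqrt ε) / (1 + Real.sqrt ε) := by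
  have hs0 : 0 < Real.sqrt ε := Real.sqrt_pos.mpr hε
  rw [Real.sqrt_div zero_le_one, Real.sqrt_one]
  field_simp

/-- **The exponential error bound**: for `ε ≤ s ≤ 1`, `|R(s)| = |1 − s P(s)| ≤ 2((1−√ε)/(1+√ε))^{n+1} = δ`
("A very important advantage of using Chebyshev polynomials is that the error of the approximation can
be bounded, and the bound converges exponentially with `n`").
[cite: BoriciDeforcrand1995, §2 eq. (12)] [cite: BunkEtAl1995, §3 eq. (17)]
[cite: FrezzottiJansen1997, eqs. (12)–(13)] -/
theorem abs_errPoly_le_delta (hε : 0 < ε) (hε1 : ε < 1) (n : ℕ) {s : ℝ} (hs : s ∈ Icc ε 1) :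
    |(errPoly ε n).eval s| ≤ delta ε n := by
  have h := abs_eval_shiftedChebyshev_le_geometric hε hε1 (n + 1) hs
  rwa [ratio_sqrt_inv_eq hε] at h

/-- The same bound in the form `|1 − s P(s)| ≤ δ`. [cite: BoriciDeforcrand1995, §2 eq. (12)] -/
theorem abs_one_sub_mul_eval_invPoly_le (hε : 0 < ε) (hε1 : ε < 1) (n : ℕ) {s : ℝ}
    (hs : s ∈ Icc ε 1) : |1 - s * (invPoly ε n).eval s| ≤ delta ε n := by
  rw [mul_eval_invPoly hε hε1, sub_sub_cancel]
  exact abs_errPoly_le_delta hε hε1 n hs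

/-- Bunk et al.'s / Frezzotti–Jansen's orientation: the relative fit error `[P(s) − 1/s]·s = sP(s) − 1`
is bounded by `δ` in absolute value on `[ε, 1]`.
[cite: BunkEtAl1995, §3 eqs. (16)–(17)] [cite: FrezzottiJansen1997, eqs. (11)–(13)] -/
theorem abs_mul_eval_invPoly_sub_one_le (hε : 0 < ε) (hε1 : ε < 1) (n : ℕ) {s : ℝ}
    (hs : s ∈ Icc ε 1) : |s * (invPoly ε n).eval s - 1| ≤ delta ε n := by
  rw [abs_sub_comm]; exact abs_one_sub_mul_eval_invPoly_le hε hε1 n hs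

/-- Two-sided form: `1 − δ ≤ s P(s) ≤ 1 + δ` on `[ε, 1]`. [cite: FrezzottiJansen1997, eqs. (11)–(13)] -/
theorem mul_eval_invPoly_mem_Icc (hε : 0 < ε) (hε1 : ε < 1) (n : ℕ) {s : ℝ} (hs : s ∈ Icc ε 1) :
    s * (invPoly ε n).eval s ∈ Icc (1 - delta ε n) (1 + delta ε n) := by
  have h := abs_le.mp (abs_mul_eval_invPoly_sub_one_le hε hε1 n hs)
  constructor <;> linarith [h.1, h.2]

/-- **The cost count behind "a modest increase `∝ Log V` in `n`"**: the bound is exponential in `n` with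
rate `≈ 2√ε`, so `n + 1 ≥ ½ ε^{−1/2} ln(2/δ₀)` terms already give `δ ≤ δ₀` (Axelsson's a-priori
Chebyshev count (5.32) at `κ = 1/ε`, through the tree's `two_mul_pow_le_of_sqrt_mul_log_le`).
[cite: BunkEtAl1995, §3 eq. (17) ("the convergence is exponential with a rate roughly equal to 2√ε")]
[cite: BoriciDeforcrand1995, §6 ("a modest increase ∝ Log V in n")] -/
theorem delta_le_of_count (hε : 0 < ε) (hε1 : ε < 1) {δ₀ : ℝ} (hδ₀ : 0 < δ₀)
    (hn : Real.sqrt (1 / ε) / 2 * Real.log (2 / δ₀) ≤ ((n + 1 : ℕ) : ℝ)) : delta ε n ≤ δ₀ := by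
  have hκ : 1 < 1 / ε := by rw [lt_div_iff₀ hε]; linarith
  have h := two_mul_pow_le_of_sqrt_mul_log_le hκ hδ₀ hn
  rwa [ratio_sqrt_inv_eq hε] at h

/-! ### Degrees -/

/-- The affine reparametrisation has degree one (private helper). [folklore] -/
private theorem natDegree_affine (hε1 : ε < 1) :
    (C ((1 + ε) / (1 - ε)) - C (2 / (1 - ε)) * X : ℝ[X]).natDegree = 1 := by
  have hd : (2 / (1 - ε) : ℝ) ≠ 0 := div_ne_zero two_ne_zero (by linarith)
  rw [natDegree_sub_eq_right_of_natDegree_lt] <;> rw [natDegree_C_mul_X _ hd]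
  rw [natDegree_C]; exact zero_lt_one

/-- `R_{n,ε}` has degree `n + 1`. [cite: BoriciDeforcrand1995, §5.1 (after eq. (25): "R(z) is a
polynomial of degree n+1 such that R(0) = 1")] -/
theorem natDegree_errPoly (hε : 0 < ε) (hε1 : ε < 1) (n : ℕ) : (errPoly ε n).natDegree = n + 1 := by
  have hc : ((Chebyshev.T ℝ (n + 1 : ℕ)).eval ((1 + ε) / (1 - ε)))⁻¹ ≠ 0 :=
    inv_ne_zero (eval_T_ratio_pos hε hε1 (n + 1)).ne'
  rw [errPoly, shiftedChebyshev, natDegree_C_mul hc, natDegree_comp, natDegree_affine hε1,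
    Chebyshev.natDegree_T]
  omega

/-- `P_{n,ε}` has degree `n` ("a real polynomial `P(x)` of even degree `n`").
[cite: BoriciDeforcrand1995, §2 (eq. (1): P(x) = c_n x^n + … + c_0)] [cite: BunkEtAl1995, §3 (P of degree n)] -/
theorem natDegree_invPoly (hε : 0 < ε) (hε1 : ε < 1) (n : ℕ) : (invPoly ε n).natDegree = n := by
  have h1 : (1 - errPoly ε n).natDegree = n + 1 := by
    rw [natDegree_sub_eq_right_of_natDegree_lt] <;>
      rw [natDegree_errPoly hε hε1]
    rw [natDegree_one]; exact Nat.succ_pos n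
  rw [invPoly, natDegree_divX_eq_natDegree_tsub_one, h1, Nat.add_sub_cancel]

/-- `P_{n,ε} ≠ 0`. [cite: BoriciDeforcrand1995, §2 eq. (1)] -/
theorem invPoly_ne_zero (hε : 0 < ε) (hε1 : ε < 1) (n : ℕ) : invPoly ε n ≠ 0 := by
  intro h
  have h2 := X_mul_invPoly hε hε1 n
  rw [h, mul_zero] at h2
  have h3 : (errPoly ε n).natDegree = 0 := by
    rw [show errPoly ε n = 1 by
      have := h2; rw [eq_comm, sub_eq_zero] at this; exact this.symm]
    exact natDegree_one
  rw [natDegree_errPoly hε hε1] at h3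
  exact Nat.succ_ne_zero n h3

end Polynomial

/-! ## §2 The roots `z_k` on the ellipse (Bunk et al. (18), Boriçi–de Forcrand (11), Frezzotti–Jansen (10)) -/

section Roots

variable {ε : ℝ} {n k : ℕ}

/-- The angles `θ_k = 2πk/(n+1)`. [cite: BunkEtAl1995, §3 eq. (18)] -/
def angle (n k : ℕ) : ℝ := 2 * π * k / (n + 1)

/-- **The roots of `P_{n,ε}`**:
`z_k = ½(1+ε) − ½(1+ε) cos(2πk/(n+1)) − i √ε sin(2πk/(n+1))`, `k = 1, …, n`.
[cite: BunkEtAl1995, §3 eq. (18)] [cite: BoriciDeforcrand1995, §2 eq. (11)]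
[cite: FrezzottiJansen1997, eq. (10)] -/
def root (ε : ℝ) (n k : ℕ) : ℂ :=
  ⟨(1 + ε) / 2 * (1 - Real.cos (angle n k)), -(Real.sqrt ε * Real.sin (angle n k))⟩

/-- `Re z_k = ½(1+ε)(1 − cos θ_k)`. [cite: BunkEtAl1995, §3 eq. (18)] -/
@[simp] theorem root_re (ε : ℝ) (n k : ℕ) :
    (root ε n k).re = (1 + ε) / 2 * (1 - Real.cos (angle n k)) := rfl

/-- `Im z_k = −√ε sin θ_k`. [cite: BunkEtAl1995, §3 eq. (18)] -/
@[simp] theorem root_im (ε : ℝ) (n k : ℕ) :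
    (root ε n k).im = -(Real.sqrt ε * Real.sin (angle n k)) := rfl

/-- Unfolding `θ_k`. [cite: BunkEtAl1995, §3 eq. (18)] -/
theorem angle_def (n k : ℕ) : angle n k = 2 * π * k / (n + 1) := rfl

/-- `(n + 1) θ_k = 2πk`. [cite: BunkEtAl1995, §3 eq. (18)] -/
theorem succ_mul_angle (n k : ℕ) : ((n : ℝ) + 1) * angle n k = 2 * π * k := by
  rw [angle]; field_simp

/-- `θ_{n+1−k} = 2π − θ_k`. [cite: Luscher1994, §3 (after (3.6): the roots pair up)] -/
theorem angle_rev (hk : k ≤ n + 1) : angle n (n + 1 - k) = 2 * π - angle n k := by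
  rw [angle, angle, Nat.cast_sub hk, Nat.cast_add, Nat.cast_one]
  field_simp

/-- **"They lie on an ellipse around the spectral interval `0 ≤ s ≤ 1`"**: the roots satisfy
`((Re z − ½(1+ε)) / (½(1+ε)))² + (Im z / √ε)² = 1` — the ellipse with centre `½(1+ε)`, semi-axes
`½(1+ε)` and `√ε`, hence foci `ε` and `1`, passing through the origin (Boriçi–de Forcrand: "the
`z_k`'s lie on the ellipse of same center and foci as `∂S`, which goes through the origin").
[cite: BunkEtAl1995, §3 (after eq. (18))] [cite: BoriciDeforcrand1995, §5.1 (after eq. (28))]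
[cite: Luscher1994, §4.5 ("the roots tend to lie on an ellipse surrounding the spectral interval")] -/
theorem root_mem_ellipse (hε : 0 < ε) (n k : ℕ) :
    (((root ε n k).re - (1 + ε) / 2) / ((1 + ε) / 2)) ^ 2 + ((root ε n k).im / Real.sqrt ε) ^ 2 = 1 := by
  have h1 : (1 + ε) / 2 ≠ 0 := by positivity
  have h2 : Real.sqrt ε ≠ 0 := (Real.sqrt_pos.mpr hε).ne'
  rw [root_re, root_im]
  have e1 : ((1 + ε) / 2 * (1 - Real.cos (angle n k)) - (1 + ε) / 2) / ((1 + ε) / 2) =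
      -Real.cos (angle n k) := by field_simp; ring
  have e2 : -(Real.sqrt ε * Real.sin (angle n k)) / Real.sqrt ε = -Real.sin (angle n k) := by
    field_simp
  rw [e1, e2, neg_sq, neg_sq, Real.cos_sq_add_sin_sq]

/-- **Complex-conjugate pairs**: `conj z_k = z_{n+1−k}` ("For even `n` they come in complex conjugate
pairs"; Lüscher (3.6): "Every value of `ν_k` occurs twice …"). [cite: Luscher1994, §3 eqs. (3.4)–(3.6)]
[cite: BunkEtAl1995, §2 (before eq. (8))] -/
theorem conj_root (ε : ℝ) (hk : k ≤ n + 1) :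
    (starRingEnd ℂ) (root ε n k) = root ε n (n + 1 - k) := by
  apply Complex.ext
  · simp [root_re, angle_rev hk, Real.cos_two_pi_sub]
  · simp [root_im, angle_rev hk, Real.sin_two_pi_sub]

/-- For `1 ≤ k ≤ n`, `θ_k` is not a multiple of `2π`: `cos θ_k ≠ 1`, so `z_k ≠ 0` (private helper).
[folklore] -/
private theorem cos_angle_ne_one (hk1 : 1 ≤ k) (hkn : k ≤ n) : Real.cos (angle n k) ≠ 1 := by
  intro h
  obtain ⟨m, hm⟩ := (Real.cos_eq_one_iff _).mp h
  rw [angle] at hm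
  have hm' : (m : ℝ) * ((n : ℝ) + 1) = k := by
    have hpi : (π : ℝ) ≠ 0 := Real.pi_ne_zero
    field_simp at hm
    linarith
  have hmz : m * ((n : ℤ) + 1) = k := by exact_mod_cast hm'
  have hm0 : 0 < m := by
    by_contra hle
    push Not at hle
    have : (m : ℤ) * ((n : ℤ) + 1) ≤ 0 := mul_nonpos_of_nonpos_of_nonneg hle (by positivity)
    omega
  have hm1 : m < 1 := by
    by_contra hge
    push Not at hge
    have : ((n : ℤ) + 1) ≤ m * ((n : ℤ) + 1) := le_mul_of_one_le_left (by positivity) hge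
    omega
  omega

/-- **The roots are non-zero** for `1 ≤ k ≤ n`. [cite: BunkEtAl1995, §3 eq. (18)] -/
theorem root_ne_zero (hε : 0 < ε) (hk1 : 1 ≤ k) (hkn : k ≤ n) : root ε n k ≠ 0 := by
  intro h
  have hre := congrArg Complex.re h
  rw [root_re, Complex.zero_re, mul_eq_zero] at hre
  rcases hre with h1 | h1
  · have : (0 : ℝ) < (1 + ε) / 2 := by positivity
    exact this.ne' h1
  · exact cos_angle_ne_one hk1 hkn (by linarith)

/-- For even `n` and `1 ≤ k ≤ n`, `sin θ_k ≠ 0` (the would-be real root `k = (n+1)/2` is absent)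
(private helper). [folklore] -/
private theorem sin_angle_ne_zero (hn : Even n) (hk1 : 1 ≤ k) (hkn : k ≤ n) :
    Real.sin (angle n k) ≠ 0 := by
  intro h
  obtain ⟨m, hm⟩ := Real.sin_eq_zero_iff.mp h
  rw [angle] at hm
  have hm' : (m : ℝ) * ((n : ℝ) + 1) = 2 * k := by
    have hpi : (π : ℝ) ≠ 0 := Real.pi_ne_zero
    field_simp at hm
    linarith
  have hmz : m * ((n : ℤ) + 1) = 2 * k := by exact_mod_cast hm'
  have hm0 : 0 < m := by
    by_contra hle
    push Not at hle
    have : (m : ℤ) * ((n : ℤ) + 1) ≤ 0 := mul_nonpos_of_nonpos_of_nonneg hle (by positivity)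
    omega
  have hm2 : m < 2 := by
    by_contra hge
    push Not at hge
    have : 2 * ((n : ℤ) + 1) ≤ m * ((n : ℤ) + 1) :=
      mul_le_mul_of_nonneg_right hge (by positivity)
    omega
  have hm1 : m = 1 := by omega
  subst hm1
  obtain ⟨t, ht⟩ := hn
  omega

/-- **Non-real roots for even `n`**: `Im z_k ≠ 0` for `1 ≤ k ≤ n` ("They … satisfy `Im z_k ≠ 0` (recall
that `n` is assumed to be even)"; Lüscher: "For even `n` they come in complex conjugate pairs with
non-zero imaginary parts"). [cite: BunkEtAl1995, §3 (after eq. (18))] [cite: Luscher1994, §3 (after (3.4))] -/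
theorem root_im_ne_zero (hε : 0 < ε) (hn : Even n) (hk1 : 1 ≤ k) (hkn : k ≤ n) :
    (root ε n k).im ≠ 0 := by
  rw [root_im, neg_ne_zero]
  exact mul_ne_zero (Real.sqrt_pos.mpr hε).ne' (sin_angle_ne_zero hn hk1 hkn)

/-- **The `n` roots are distinct**: `k ↦ z_k` is injective on `{1, …, n}`.
[cite: BoriciDeforcrand1995, §2 eqs. (9), (11) (P = c_n ∏ₖ (x − z_k) with the n listed roots)] -/
theorem root_injOn (hε : 0 < ε) (n : ℕ) : Set.InjOn (root ε n) (Finset.Icc 1 n : Set ℕ) := by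
  intro j hj l hl hjl
  simp only [Finset.coe_Icc, Set.mem_Icc] at hj hl
  have hre := congrArg Complex.re hjl
  have him := congrArg Complex.im hjl
  simp only [root_re, root_im] at hre him
  have hcos : Real.cos (angle n j) = Real.cos (angle n l) := by
    have h2 : (0 : ℝ) < (1 + ε) / 2 := by positivity
    have := mul_left_cancel₀ h2.ne' hre
    linarith
  have hsin : Real.sin (angle n j) = Real.sin (angle n l) := by
    have h2 : Real.sqrt ε ≠ 0 := (Real.sqrt_pos.mpr hε).ne'
    have := neg_injective him
    exact mul_left_cancel₀ h2 this
  -- `cos(θ_j − θ_l) = 1`, hence `θ_j − θ_l ∈ 2πℤ`, hence `j = l`.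
  have hone : Real.cos (angle n j - angle n l) = 1 := by
    rw [Real.cos_sub, hcos, hsin, ← sq, ← sq, Real.cos_sq_add_sin_sq]
  obtain ⟨m, hm⟩ := (Real.cos_eq_one_iff _).mp hone
  rw [angle, angle] at hm
  have hm' : (m : ℝ) * ((n : ℝ) + 1) = (j : ℝ) - l := by
    have hpi : (π : ℝ) ≠ 0 := Real.pi_ne_zero
    field_simp at hm
    linarith
  have hmz : m * ((n : ℤ) + 1) = (j : ℤ) - l := by exact_mod_cast hm'
  have hm0 : m = 0 := by
    rcases lt_trichotomy m 0 with hneg | h0 | hpos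
    · have : m * ((n : ℤ) + 1) ≤ -1 * ((n : ℤ) + 1) :=
        mul_le_mul_of_nonneg_right (by omega) (by positivity)
      omega
    · exact h0
    · have : 1 * ((n : ℤ) + 1) ≤ m * ((n : ℤ) + 1) :=
        mul_le_mul_of_nonneg_right (by omega) (by positivity)
      omega
  subst hm0
  simp only [zero_mul] at hmz
  omega

/-! ### `R(z_k) = 1`: the roots of `P_{n,ε}` are exactly the `z_k` -/

/-- The parameter `β = log((1+√ε)/(1−√ε))` of the ellipses `cos(θ − iβ)` through the roots, with
`cosh β = (1+ε)/(1−ε)` and `sinh β = 2√ε/(1−ε)` (Lüscher (4.16): "`cosh β = (1+ε)/(1−ε)`").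
[cite: Luscher1994, §4.3 eq. (4.16)] -/
def beta (ε : ℝ) : ℝ := Real.log ((1 + Real.sqrt ε) / (1 - Real.sqrt ε))

/-- `cosh β = (1+ε)/(1−ε)`. [cite: Luscher1994, §4.3 eq. (4.16)] -/
theorem cosh_beta (hε : 0 < ε) (hε1 : ε < 1) : Real.cosh (beta ε) = (1 + ε) / (1 - ε) := by
  have hs1 : Real.sqrt ε < 1 := by
    rw [show (1 : ℝ) = Real.sqrt 1 by simp]
    exact Real.sqrt_lt_sqrt hε.le hε1
  have hs0 : 0 < Real.sqrt ε := Real.sqrt_pos.mpr hε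
  have hq : 0 < (1 + Real.sqrt ε) / (1 - Real.sqrt ε) := div_pos (by linarith) (by linarith)
  rw [beta, Real.cosh_eq, Real.exp_neg, Real.exp_log hq, inv_div]
  have hss : Real.sqrt ε * Real.sqrt ε = ε := Real.mul_self_sqrt hε.le
  have h1 : 1 - Real.sqrt ε ≠ 0 := by linarith
  have h2 : 1 + Real.sqrt ε ≠ 0 := by linarith
  have h3 : 1 - ε ≠ 0 := by linarith
  field_simp
  nlinarith [hss]

/-- `sinh β = 2√ε/(1−ε)`. [cite: Luscher1994, §4.3 eq. (4.16) and §4.5 eq. (4.32) (semi-axes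
`½(1+ε) = ½(1−ε)cosh β`, `½(1−ε) sinh β`)] -/
theorem sinh_beta (hε : 0 < ε) (hε1 : ε < 1) : Real.sinh (beta ε) = 2 * Real.sqrt ε / (1 - ε) := by
  have hs1 : Real.sqrt ε < 1 := by
    rw [show (1 : ℝ) = Real.sqrt 1 by simp]
    exact Real.sqrt_lt_sqrt hε.le hε1
  have hs0 : 0 < Real.sqrt ε := Real.sqrt_pos.mpr hε
  have hq : 0 < (1 + Real.sqrt ε) / (1 - Real.sqrt ε) := div_pos (by linarith) (by linarith)
  rw [beta, Real.sinh_eq, Real.exp_neg, Real.exp_log hq, inv_div]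
  have hss : Real.sqrt ε * Real.sqrt ε = ε := Real.mul_self_sqrt hε.le
  have h1 : 1 - Real.sqrt ε ≠ 0 := by linarith
  have h2 : 1 + Real.sqrt ε ≠ 0 := by linarith
  have h3 : 1 - ε ≠ 0 := by linarith
  field_simp
  nlinarith [hss]

/-- `T_{n+1}((1+ε)/(1−ε)) = cosh((n+1)β)` (Lüscher's `α⁻¹`-type constants are hyperbolic cosines of
multiples of `β`). [cite: Luscher1994, §4.3 eqs. (4.15)–(4.16)] [cite: BoriciDeforcrand1995, §5.1 eqs.
(30)–(33) (θ₀ = π + iα, |R| ≤ cosh((n+1)θ₂)/cosh((n+1)α))] -/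
theorem eval_T_eq_cosh (hε : 0 < ε) (hε1 : ε < 1) (n : ℕ) :
    (Chebyshev.T ℝ (n + 1 : ℕ)).eval ((1 + ε) / (1 - ε)) = Real.cosh (((n : ℝ) + 1) * beta ε) := by
  rw [← cosh_beta hε hε1, Polynomial.Chebyshev.T_real_cosh]
  push_cast; ring_nf

/-- **The sharp uniform bound** `|R(s)| ≤ 1/cosh((n+1)β)` on `[ε, 1]` (attained at the Chebyshev
extrema; Boriçi–de Forcrand (33) at `θ₂ = 0`), of which `δ = 2e^{−(n+1)β}` is the convenient majorant
since `e^{−β} = (1−√ε)/(1+√ε)`. [cite: BoriciDeforcrand1995, §5.1 eqs. (33)–(34)] -/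
theorem abs_errPoly_le_inv_cosh (hε : 0 < ε) (hε1 : ε < 1) (n : ℕ) {s : ℝ} (hs : s ∈ Icc ε 1) :
    |(errPoly ε n).eval s| ≤ (Real.cosh (((n : ℝ) + 1) * beta ε))⁻¹ := by
  rw [← eval_T_eq_cosh hε hε1, ← one_div]
  exact abs_eval_shiftedChebyshev_le hε hε1 (n + 1) hs

/-- `β > 0`. [cite: Luscher1994, §4.3 eq. (4.16)] -/
theorem beta_pos (hε : 0 < ε) (hε1 : ε < 1) : 0 < beta ε := by
  have hs1 : Real.sqrt ε < 1 := by
    rw [show (1 : ℝ) = Real.sqrt 1 by simp]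
    exact Real.sqrt_lt_sqrt hε.le hε1
  have hs0 : 0 < Real.sqrt ε := Real.sqrt_pos.mpr hε
  refine Real.log_pos ?_
  rw [one_lt_div (by linarith)]; linarith

/-- `1/cosh((n+1)β) < 1`: the uniform error on the fit range is strictly below one, so every factor
`sP(s) = 1 − R(s)`, `ε ≤ s ≤ 1`, is strictly positive. [cite: BoriciDeforcrand1995, §5.1 eq. (33)] -/
theorem inv_cosh_lt_one (hε : 0 < ε) (hε1 : ε < 1) (n : ℕ) :
    (Real.cosh (((n : ℝ) + 1) * beta ε))⁻¹ < 1 := by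
  refine inv_lt_one_of_one_lt₀ (Real.one_lt_cosh.mpr ?_)
  exact mul_ne_zero (by positivity) (beta_pos hε hε1).ne'

/-- **`sP(s) > 0` on `[ε, 1]`** (for every `n`). [cite: BoriciDeforcrand1995, §2 eqs. (12)–(14)] -/
theorem mul_eval_invPoly_pos_of_mem (hε : 0 < ε) (hε1 : ε < 1) (n : ℕ) {s : ℝ} (hs : s ∈ Icc ε 1) :
    0 < s * (invPoly ε n).eval s := by
  rw [mul_eval_invPoly hε hε1]
  have h := (abs_le.mp (abs_errPoly_le_inv_cosh hε hε1 n hs)).2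
  linarith [inv_cosh_lt_one hε hε1 n]

/-- The affine image of `z_k` is a point of the ellipse `cos(θ_k − iβ)`:
`(1+ε)/(1−ε) − 2 z_k/(1−ε) = cos(θ_k − iβ)` (Boriçi–de Forcrand (26): "`w = cos θ = cos θ₁ cosh θ₂ −
i sin θ₁ sinh θ₂` … for `θ₂` fixed, `w(θ₁)` describes an ellipse"). [cite: BoriciDeforcrand1995, §5.1
eqs. (26)–(28)] [cite: Luscher1994, §4.5 eq. (4.32)] -/
theorem affine_root_eq_cos (hε : 0 < ε) (hε1 : ε < 1) (n k : ℕ) :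
    (((1 + ε) / (1 - ε) : ℝ) : ℂ) - ((2 / (1 - ε) : ℝ) : ℂ) * root ε n k =
      Complex.cos ((angle n k : ℂ) - (beta ε : ℂ) * Complex.I) := by
  rw [Complex.cos_sub, Complex.cos_mul_I, Complex.sin_mul_I, ← Complex.ofReal_cos, ← Complex.ofReal_sin,
    ← Complex.ofReal_cosh, ← Complex.ofReal_sinh, cosh_beta hε hε1, sinh_beta hε hε1]
  have h3 : (1 - ε : ℝ) ≠ 0 := by linarith
  apply Complex.ext
  · simp only [Complex.sub_re, Complex.ofReal_re, Complex.mul_re, Complex.ofReal_im, root_re, root_im,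
      Complex.add_re, Complex.mul_im, Complex.I_re, Complex.I_im]
    field_simp
    ring
  · simp only [Complex.sub_im, Complex.ofReal_im, Complex.mul_im, Complex.ofReal_re, root_re, root_im,
      Complex.add_im, Complex.mul_re, Complex.I_re, Complex.I_im]
    field_simp
    ring

/-- `aeval` at a real point, coerced (private helper). [folklore] -/
private theorem aeval_ofReal' (q : ℝ[X]) (x : ℝ) : aeval (x : ℂ) q = ((q.eval x : ℝ) : ℂ) :=
  aeval_algebraMap_apply_eq_algebraMap_eval x q

/-- `aeval` of `R` through the complexified polynomial (private helper). [folklore] -/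
private theorem aeval_errPoly_eq (ε : ℝ) (n : ℕ) (z : ℂ) :
    aeval z (errPoly ε n) =
      ((((Chebyshev.T ℝ (n + 1 : ℕ)).eval ((1 + ε) / (1 - ε)))⁻¹ : ℝ) : ℂ) *
        (Chebyshev.T ℂ (n + 1 : ℕ)).eval
          ((((1 + ε) / (1 - ε) : ℝ) : ℂ) - ((2 / (1 - ε) : ℝ) : ℂ) * z) := by
  rw [errPoly, shiftedChebyshev, map_mul, aeval_C, Polynomial.aeval_comp]
  simp only [map_sub, map_mul, Complex.coe_algebraMap, Polynomial.aeval_def,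
    Polynomial.eval₂_eq_eval_map, Polynomial.Chebyshev.map_T]
  norm_num

/-- **`R(z_k) = 1` for every `k`** — "By straightforward algebra, one verifies that the zeroes of `P(x)`
… are given by" the `z_k`: with `(1+ε)/(1−ε) − 2z_k/(1−ε) = cos(θ_k − iβ)` and `T_{n+1}(cos w) =
cos((n+1)w)`, `T_{n+1}` takes the value `cos(2πk − i(n+1)β) = cosh((n+1)β) = T_{n+1}((1+ε)/(1−ε))`.
[cite: BoriciDeforcrand1995, §2 eqs. (10)–(11)] [cite: BunkEtAl1995, §3 eq. (18)] -/
theorem aeval_root_errPoly (hε : 0 < ε) (hε1 : ε < 1) (n k : ℕ) :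
    aeval (root ε n k) (errPoly ε n) = 1 := by
  rw [aeval_errPoly_eq, affine_root_eq_cos hε hε1, Polynomial.Chebyshev.T_complex_cos]
  have harg : (((n + 1 : ℕ) : ℤ) : ℂ) * ((angle n k : ℂ) - (beta ε : ℂ) * Complex.I) =
      (k : ℂ) * (2 * π) - (((n : ℝ) + 1) * beta ε : ℝ) * Complex.I := by
    have h := succ_mul_angle n k
    push_cast
    rw [mul_sub, ← mul_assoc]
    congr 1
    rw [show ((n : ℂ) + 1) * (angle n k : ℂ) = (((n : ℝ) + 1) * angle n k : ℝ) by push_cast; ring, h]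
    push_cast; ring
  rw [harg, Complex.cos_nat_mul_two_pi_sub, Complex.cos_mul_I, ← Complex.ofReal_cosh,
    ← cosh_beta hε hε1, Polynomial.Chebyshev.T_real_cosh, ← Complex.ofReal_mul]
  rw [show (((n + 1 : ℕ) : ℤ) : ℝ) * beta ε = ((n : ℝ) + 1) * beta ε by push_cast; ring]
  rw [inv_mul_cancel₀ (Real.cosh_pos _).ne', Complex.ofReal_one]

/-- **Each `z_k`, `1 ≤ k ≤ n`, is a root of `P_{n,ε}`** (over `ℂ`): `z_k P(z_k) = 1 − R(z_k) = 0` and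
`z_k ≠ 0`. [cite: BoriciDeforcrand1995, §2 eqs. (9), (11)] [cite: BunkEtAl1995, §3 eq. (18)]
[cite: FrezzottiJansen1997, eqs. (9)–(10)] -/
theorem isRoot_invPoly_root (hε : 0 < ε) (hε1 : ε < 1) (hk1 : 1 ≤ k) (hkn : k ≤ n) :
    ((invPoly ε n).map (algebraMap ℝ ℂ)).IsRoot (root ε n k) := by
  have h := congrArg (fun p : ℝ[X] => aeval (root ε n k) p) (X_mul_invPoly hε hε1 n)
  simp only [map_mul, aeval_X, map_sub, map_one, aeval_root_errPoly hε hε1, sub_self,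
    mul_eq_zero, root_ne_zero hε hk1 hkn, false_or] at h
  rwa [IsRoot, Polynomial.eval_map_algebraMap]

/-- **Factorisation over `ℂ`**: `P_{n,ε}(x) = c_n ∏_{k=1}^{n} (x − z_k)` with `c_n` the leading
coefficient ("decompose `P(x)` into a product of monomials").
[cite: BoriciDeforcrand1995, §2 eqs. (1), (9)] [cite: FrezzottiJansen1997, eq. (9)] -/
theorem map_invPoly_eq_prod (hε : 0 < ε) (hε1 : ε < 1) (n : ℕ) :
    (invPoly ε n).map (algebraMap ℝ ℂ) =
      C (((invPoly ε n).leadingCoeff : ℝ) : ℂ) * ∏ k ∈ Finset.Icc 1 n, (X - C (root ε n k)) := by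
  set Pc := (invPoly ε n).map (algebraMap ℝ ℂ) with hPc
  have hinj : Function.Injective (algebraMap ℝ ℂ) := (algebraMap ℝ ℂ).injective
  have hPc0 : Pc ≠ 0 := (Polynomial.map_ne_zero_iff hinj).mpr (invPoly_ne_zero hε hε1 n)
  have hdeg : Pc.natDegree = n := by
    rw [hPc, natDegree_map_eq_of_injective hinj, natDegree_invPoly hε hε1]
  set S : Finset ℂ := (Finset.Icc 1 n).image (root ε n) with hS
  have hcard : S.card = n := by
    rw [hS, Finset.card_image_of_injOn (root_injOn hε n), Nat.card_Icc, Nat.add_sub_cancel]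
  have hroots : ∀ x ∈ S, Pc.eval x = 0 := by
    intro x hx
    obtain ⟨k, hk, rfl⟩ := Finset.mem_image.mp hx
    rw [Finset.mem_Icc] at hk
    exact isRoot_invPoly_root hε hε1 hk.1 hk.2
  have hR : Pc.roots = S.val :=
    roots_eq_of_natDegree_le_card_of_ne_zero hroots (by rw [hdeg, hcard]) hPc0
  have hcard' : Pc.roots.card = Pc.natDegree := by rw [hR, hdeg, ← hcard]; rfl
  have hfac := C_leadingCoeff_mul_prod_multiset_X_sub_C hcard'
  rw [hR, ← Finset.prod_eq_multiset_prod, hS, Finset.prod_image (root_injOn hε n)] at hfac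
  rw [← hfac, hPc, leadingCoeff_map_of_injective hinj]
  rfl

/-- Every complex root of `P_{n,ε}` is one of the `z_k` (private helper: the `n` listed roots exhaust
the roots of the degree-`n` polynomial). [folklore] -/
private theorem exists_eq_root_of_isRoot (hε : 0 < ε) (hε1 : ε < 1) {z : ℂ}
    (hz : ((invPoly ε n).map (algebraMap ℝ ℂ)).IsRoot z) : ∃ k, 1 ≤ k ∧ k ≤ n ∧ z = root ε n k := by
  have h := hz
  rw [IsRoot, map_invPoly_eq_prod hε hε1 n, eval_mul, eval_C, Polynomial.eval_prod, mul_eq_zero] at h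
  rcases h with h | h
  · exact absurd (Complex.ofReal_eq_zero.mp h) (leadingCoeff_ne_zero.mpr (invPoly_ne_zero hε hε1 n))
  · obtain ⟨k, hk, hk0⟩ := Finset.prod_eq_zero_iff.mp h
    rw [Finset.mem_Icc] at hk
    simp only [eval_sub, eval_X, eval_C, sub_eq_zero] at hk0
    exact ⟨k, hk.1, hk.2, hk0⟩

/-- **For even `n`, `P_{n,ε}` has no real root** (all `z_k` have `Im z_k ≠ 0`).
[cite: BunkEtAl1995, §3 (after eq. (18))] [cite: Luscher1994, §4.5 ("its roots thus come in complex
conjugate pairs with non-zero imaginary parts")] -/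
theorem eval_invPoly_ne_zero (hε : 0 < ε) (hε1 : ε < 1) (hn : Even n) (s : ℝ) :
    (invPoly ε n).eval s ≠ 0 := by
  intro h
  have hz : ((invPoly ε n).map (algebraMap ℝ ℂ)).IsRoot (s : ℂ) := by
    rw [IsRoot, Polynomial.eval_map_algebraMap, aeval_ofReal', h, Complex.ofReal_zero]
  obtain ⟨k, hk1, hkn, hk⟩ := exists_eq_root_of_isRoot hε hε1 hz
  have := congrArg Complex.im hk
  rw [Complex.ofReal_im] at this
  exact root_im_ne_zero hε hn hk1 hkn this.symm

/-- **`P_{n,ε}(s) > 0` for all real `s` when `n` is even** ("The polynomial `P(s)` can then be shown to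
be positive for all `s`"): it has no real root and `εP(ε) = 1 − 1/T_{n+1}((1+ε)/(1−ε)) > 0`.
[cite: Luscher1994, §4.5 (before eq. (4.24))] [cite: FrezzottiJansen1997, (after eq. (4)):
"P_n(λ(Q²)) > 0 for all the eigenvalues … in the range 0 ≤ λ(Q²) < 1"] -/
theorem eval_invPoly_pos (hε : 0 < ε) (hε1 : ε < 1) (hn : Even n) (s : ℝ) :
    0 < (invPoly ε n).eval s := by
  -- value at `ε`: `ε P(ε) = 1 − R(ε) = 1 − 1/T_{n+1}(x₀) > 0`
  have hT1 : 1 < (Chebyshev.T ℝ (n + 1 : ℕ)).eval ((1 + ε) / (1 - ε)) := by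
    refine Polynomial.Chebyshev.one_lt_eval_T_real (by omega) ?_
    rw [lt_div_iff₀ (by linarith)]; linarith
  have h3 : (1 - ε : ℝ) ≠ 0 := by linarith
  have hRε : (errPoly ε n).eval ε < 1 := by
    rw [eval_errPoly, show (1 + ε) / (1 - ε) - 2 / (1 - ε) * ε = 1 by field_simp; ring,
      Polynomial.Chebyshev.T_eval_one, mul_one]
    exact inv_lt_one_of_one_lt₀ hT1
  have hPε : 0 < (invPoly ε n).eval ε := by
    have h := mul_eval_invPoly hε hε1 n ε
    nlinarith
  -- no real zero + continuity ⇒ constant sign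
  by_contra hle
  push Not at hle
  have hcont : Continuous fun x : ℝ => (invPoly ε n).eval x := (invPoly ε n).continuous
  rcases le_or_gt s ε with hsε | hsε
  · obtain ⟨r, _, hr⟩ := intermediate_value_Icc hsε hcont.continuousOn ⟨hle, hPε.le⟩
    exact eval_invPoly_ne_zero hε hε1 hn r hr
  · obtain ⟨r, _, hr⟩ := intermediate_value_Icc' hsε.le hcont.continuousOn ⟨hle, hPε.le⟩
    exact eval_invPoly_ne_zero hε hε1 hn r hr

/-- **The leading coefficient `c_n` is positive for even `n`** (the normalisation "`κ > 0`" of the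
multiboson filter). [cite: BoriciDeforcrand1995, §3 eq. (16) (c_n computed)] [cite: Luscher1994, §4.5] -/
theorem leadingCoeff_invPoly_pos (hε : 0 < ε) (hε1 : ε < 1) (hn : Even n) :
    0 < (invPoly ε n).leadingCoeff := by
  by_contra hle
  push Not at hle
  rcases Nat.eq_zero_or_pos n with h0 | hpos
  · -- degree 0: `P` is the constant `c_0 = P(ε) > 0`
    subst h0
    have hP := eval_invPoly_pos hε hε1 hn ε
    have hdeg := natDegree_invPoly hε hε1 0
    rw [eq_C_of_natDegree_eq_zero hdeg, eval_C] at hP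
    rw [leadingCoeff, hdeg] at hle
    exact absurd hP (not_lt.mpr hle)
  · have hdeg : 0 < (invPoly ε n).degree := by
      rw [degree_eq_natDegree (invPoly_ne_zero hε hε1 n), natDegree_invPoly hε hε1]
      exact_mod_cast hpos
    have ht := (invPoly ε n).tendsto_atBot_of_leadingCoeff_nonpos hdeg hle
    obtain ⟨x, hx⟩ := (ht.eventually (Filter.eventually_lt_atBot 0)).exists
    exact absurd (eval_invPoly_pos hε hε1 hn x) (not_lt.mpr hx.le)

/-- **Boriçi–de Forcrand's normalisation (16)** for even `n`: `R(½(1+ε)) = 0` (since `T_{n+1}(0) = 0`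
for odd `n + 1`), hence `½(1+ε) · P(½(1+ε)) = 1`, i.e. `c_n⁻¹ = ½(1+ε) ∏ₖ (½(1+ε) − z_k)`.
[cite: BoriciDeforcrand1995, §3 eq. (16)] -/
theorem mid_mul_eval_invPoly (hε : 0 < ε) (hε1 : ε < 1) (hn : Even n) :
    (1 + ε) / 2 * (invPoly ε n).eval ((1 + ε) / 2) = 1 := by
  have hodd : Odd (((n + 1 : ℕ) : ℤ)) := by
    obtain ⟨t, ht⟩ := hn
    exact ⟨t, by push_cast; omega⟩
  have h3 : (1 - ε : ℝ) ≠ 0 := by linarith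
  rw [mul_eval_invPoly hε hε1, eval_errPoly,
    show (1 + ε) / (1 - ε) - 2 / (1 - ε) * ((1 + ε) / 2) = 0 by field_simp; ring,
    Polynomial.Chebyshev.T_eval_zero_of_odd ℝ hodd, mul_zero, sub_zero]

/-- The same normalisation in product form: `c_n · ½(1+ε) · ∏ₖ (½(1+ε) − z_k) = 1`.
[cite: BoriciDeforcrand1995, §3 eq. (16)] -/
theorem leadingCoeff_mul_prod_mid_sub_root (hε : 0 < ε) (hε1 : ε < 1) (hn : Even n) :
    (((invPoly ε n).leadingCoeff : ℝ) : ℂ) * ((((1 + ε) / 2 : ℝ) : ℂ) *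
      ∏ k ∈ Finset.Icc 1 n, ((((1 + ε) / 2 : ℝ) : ℂ) - root ε n k)) = 1 := by
  have h := mid_mul_eval_invPoly hε hε1 hn
  have h2 := congrArg (fun q : ℂ[X] => q.eval ((((1 + ε) / 2 : ℝ)) : ℂ)) (map_invPoly_eq_prod hε hε1 n)
  simp only [Polynomial.eval_map_algebraMap, aeval_ofReal', eval_mul, eval_C, Polynomial.eval_prod,
    eval_sub, eval_X] at h2
  rw [mul_left_comm, ← h2, ← Complex.ofReal_mul, h, Complex.ofReal_one]

end Roots

/-! ## §3 Lüscher's square roots `μ_k + iν_k = √z_k`, `ν_k > 0`, and the positive factorisation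
`P(Q²) = c_n ∏ₖ [(Q − μ_k)² + ν_k²]` (Lüscher (3.5)–(3.6); Bunk et al. (8)–(9)) -/

section SquareRoots

open ComplexConjugate

variable {z w : ℂ}

/-- **Lüscher's branch of the square root**: the square root with NON-NEGATIVE imaginary part
(`μ_k + iν_k = √z_k`, `ν_k > 0` — for `z ∉ [0, ∞)` the imaginary part is strictly positive,
`im_usqrt_pos`).  It is Mathlib's principal branch `z ^ (1/2)` reflected when `Im z < 0`.
[cite: Luscher1994, §3 eq. (3.6)] [cite: BunkEtAl1995, §2 eq. (9)] -/
def usqrt (z : ℂ) : ℂ := if 0 ≤ z.im then z ^ (2⁻¹ : ℂ) else -(z ^ (2⁻¹ : ℂ))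

/-- `(√z)² = z`. [cite: Luscher1994, §3 eq. (3.6)] -/
theorem usqrt_sq (z : ℂ) : usqrt z ^ 2 = z := by
  have h : (z ^ (2⁻¹ : ℂ)) ^ 2 = z := by
    have := Complex.cpow_nat_inv_pow z two_ne_zero
    rw [Nat.cast_ofNat] at this
    exact this
  unfold usqrt
  split_ifs
  · exact h
  · rw [neg_sq]; exact h

/-- The imaginary part `ν = Im √z = √((|z| − Re z)/2) ≥ 0`. [cite: Luscher1994, §3 eq. (3.6) (ν_k > 0)] -/
theorem usqrt_im (z : ℂ) : (usqrt z).im = Real.sqrt ((‖z‖ - z.re) / 2) := by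
  unfold usqrt
  split_ifs with h
  · exact Complex.cpow_inv_two_im_eq_sqrt h
  · rw [Complex.neg_im, Complex.cpow_inv_two_im_eq_neg_sqrt (lt_of_not_ge h), neg_neg]

/-- The modulus of the real part `|μ| = |Re √z| = √((|z| + Re z)/2)`.
[cite: Luscher1994, §3 eq. (3.6) ("the corresponding μ_k's have equal magnitude")] -/
theorem abs_usqrt_re (z : ℂ) : |(usqrt z).re| = Real.sqrt ((‖z‖ + z.re) / 2) := by
  unfold usqrt
  split_ifs
  · rw [Complex.cpow_inv_two_re, abs_of_nonneg (Real.sqrt_nonneg _)]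
  · rw [Complex.neg_re, abs_neg, Complex.cpow_inv_two_re, abs_of_nonneg (Real.sqrt_nonneg _)]

/-- `ν = Im √z ≥ 0`. [cite: Luscher1994, §3 eq. (3.6)] -/
theorem usqrt_im_nonneg (z : ℂ) : 0 ≤ (usqrt z).im := by
  rw [usqrt_im]; exact Real.sqrt_nonneg _

/-- **`ν > 0` off the non-negative real axis**: if `Im z ≠ 0` then `Im √z > 0`.
[cite: Luscher1994, §3 eq. (3.6)] -/
theorem usqrt_im_pos (hz : z.im ≠ 0) : 0 < (usqrt z).im := by
  rw [usqrt_im]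
  apply Real.sqrt_pos.mpr
  have h := Complex.abs_re_lt_norm.mpr hz
  have h2 : z.re < ‖z‖ := lt_of_le_of_lt (le_abs_self _) h
  linarith

/-- Uniqueness of the root with positive imaginary part (private helper). [folklore] -/
private theorem eq_of_sq_eq_of_im_pos {a b : ℂ} (hab : a ^ 2 = b ^ 2) (ha : 0 < a.im) (hb : 0 < b.im) :
    a = b := by
  rcases sq_eq_sq_iff_eq_or_eq_neg.mp hab with h | h
  · exact h
  · exfalso
    have := congrArg Complex.im h
    rw [Complex.neg_im] at this
    linarith

/-- Characterisation: for `Im z ≠ 0`, `√z` is THE square root of `z` with positive imaginary part.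
[cite: Luscher1994, §3 eq. (3.6)] -/
theorem usqrt_eq_of_sq_eq (hz : z.im ≠ 0) (hw : w ^ 2 = z) (hpos : 0 < w.im) : usqrt z = w :=
  eq_of_sq_eq_of_im_pos (by rw [usqrt_sq, hw]) (usqrt_im_pos hz) hpos

/-- **Lüscher's pairing**: `√(z̄) = −conj(√z)` for `Im z ≠ 0` — conjugate roots `z_k, z̄_k` have square
roots with EQUAL `ν` and OPPOSITE `μ` ("Every value of `ν_k` occurs twice and the corresponding `μ_k`'s
have equal magnitude and opposite sign"). [cite: Luscher1994, §3 (after eq. (3.6))] -/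
theorem usqrt_conj (hz : z.im ≠ 0) : usqrt (conj z) = -conj (usqrt z) := by
  refine usqrt_eq_of_sq_eq (by rwa [Complex.conj_im, neg_ne_zero]) ?_ ?_
  · rw [neg_sq, ← map_pow, usqrt_sq]
  · rw [Complex.neg_im, Complex.conj_im, neg_neg]; exact usqrt_im_pos hz

/-- `Re √(z̄) = −Re √z`. [cite: Luscher1994, §3 (after eq. (3.6))] -/
theorem usqrt_conj_re (hz : z.im ≠ 0) : (usqrt (conj z)).re = -(usqrt z).re := by
  rw [usqrt_conj hz, Complex.neg_re, Complex.conj_re]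

/-- `Im √(z̄) = Im √z`. [cite: Luscher1994, §3 (after eq. (3.6))] -/
theorem usqrt_conj_im (hz : z.im ≠ 0) : (usqrt (conj z)).im = (usqrt z).im := by
  rw [usqrt_conj hz, Complex.neg_im, Complex.conj_im, neg_neg]

end SquareRoots

section Factorisation

open ComplexConjugate

variable {ε : ℝ} {n k : ℕ}

/-- `μ_k = Re √z_k`. [cite: Luscher1994, §3 eq. (3.6)] [cite: BunkEtAl1995, §2 eq. (9)] -/
def rootMu (ε : ℝ) (n k : ℕ) : ℝ := (usqrt (root ε n k)).re

/-- `ν_k = Im √z_k` (`> 0` for even `n`). [cite: Luscher1994, §3 eq. (3.6)] [cite: BunkEtAl1995, §2 eq. (9)] -/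
def rootNu (ε : ℝ) (n k : ℕ) : ℝ := (usqrt (root ε n k)).im

/-- `√z_k = μ_k + iν_k`. [cite: Luscher1994, §3 eq. (3.6)] -/
theorem usqrt_root_eq (ε : ℝ) (n k : ℕ) :
    usqrt (root ε n k) = (rootMu ε n k : ℂ) + (rootNu ε n k : ℂ) * Complex.I :=
  (Complex.re_add_im _).symm

/-- `(μ_k + iν_k)² = z_k`. [cite: Luscher1994, §3 eq. (3.6)] -/
theorem rootMu_add_rootNu_sq (ε : ℝ) (n k : ℕ) :
    ((rootMu ε n k : ℂ) + (rootNu ε n k : ℂ) * Complex.I) ^ 2 = root ε n k := by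
  rw [← usqrt_root_eq, usqrt_sq]

/-- **`ν_k > 0`** for even `n`, `1 ≤ k ≤ n`. [cite: Luscher1994, §3 eq. (3.6)] [cite: BunkEtAl1995, §2 eq. (9)] -/
theorem rootNu_pos (hε : 0 < ε) (hn : Even n) (hk1 : 1 ≤ k) (hkn : k ≤ n) : 0 < rootNu ε n k :=
  usqrt_im_pos (root_im_ne_zero hε hn hk1 hkn)

/-- **"Every value of `ν_k` occurs twice"**: `ν_{n+1−k} = ν_k` (even `n`, `1 ≤ k ≤ n`).
[cite: Luscher1994, §3 (after eq. (3.6))] -/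
theorem rootNu_rev (hε : 0 < ε) (hn : Even n) (hk1 : 1 ≤ k) (hkn : k ≤ n) :
    rootNu ε n (n + 1 - k) = rootNu ε n k := by
  rw [rootNu, rootNu, ← conj_root ε (by omega), usqrt_conj_im (root_im_ne_zero hε hn hk1 hkn)]

/-- **"… and the corresponding `μ_k`'s have equal magnitude and opposite sign"**: `μ_{n+1−k} = −μ_k`.
[cite: Luscher1994, §3 (after eq. (3.6))] -/
theorem rootMu_rev (hε : 0 < ε) (hn : Even n) (hk1 : 1 ≤ k) (hkn : k ≤ n) :
    rootMu ε n (n + 1 - k) = -rootMu ε n k := by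
  rw [rootMu, rootMu, ← conj_root ε (by omega), usqrt_conj_re (root_im_ne_zero hε hn hk1 hkn)]

/-- The quadratic factor `(X − μ)² + ν²` is `(X − w)(X − w̄)` for `w = μ + iν` (private helper).
[folklore] -/
private theorem quad_eq_mul_conj (w : ℂ) :
    ((X - C (w.re : ℂ)) ^ 2 + C ((w.im : ℂ) ^ 2) : ℂ[X]) = (X - C w) * (X - C (conj w)) := by
  have hcw : conj w = (w.re : ℂ) - (w.im : ℂ) * Complex.I := by
    apply Complex.ext <;> simp
  have hw : w = (w.re : ℂ) + (w.im : ℂ) * Complex.I := (Complex.re_add_im w).symm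
  generalize (w.re : ℂ) = a at hcw hw ⊢
  generalize (w.im : ℂ) = b at hcw hw ⊢
  rw [hcw, hw]
  simp only [map_add, map_sub, map_mul, map_pow]
  have hI : (C Complex.I : ℂ[X]) ^ 2 = -1 := by rw [← map_pow, Complex.I_sq, map_neg, map_one]
  linear_combination (C b) ^ 2 * hI

/-- **The pairing identity behind (3.5), for any finite family of roots closed under `w ↦ −w̄`**: if
`σ` is an involution of the index set with `w_{σ(k)} = −conj(w_k)` (Lüscher's `√z̄_k = −conj √z_k`),
then `∏ₖ [(X − Re w_k)² + (Im w_k)²] = ∏ₖ (X² − w_k²)` in `ℂ[X]`.  (With PRINCIPAL square roots the set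
`{√z_k}` is not closed under `w ↦ −w̄` and the factor-by-factor identity fails; the branch `ν_k > 0` of
(3.6) is what makes Boriçi–de Forcrand's (2) `det P(Q²) = c_nᴺ ∏ₖ det(Q − √z̄_k) det(Q − √z_k)` and
Frezzotti–Jansen's (9) `∏ₖ[(Q − √z_k*)(Q − √z_k)]` correct.)
[cite: Luscher1994, §3 eqs. (3.5)–(3.6)] [cite: BoriciDeforcrand1995, §2 eq. (2)]
[cite: FrezzottiJansen1997, eq. (9)] -/
theorem prod_quad_eq_prod_sq_sub {ι : Type*} (s : Finset ι) (w : ι → ℂ) (σ : ι → ι)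
    (hσs : ∀ k ∈ s, σ k ∈ s) (hσσ : ∀ k ∈ s, σ (σ k) = k) (hw : ∀ k ∈ s, w (σ k) = -conj (w k)) :
    ∏ k ∈ s, ((X - C ((w k).re : ℂ)) ^ 2 + C (((w k).im : ℂ) ^ 2)) =
      ∏ k ∈ s, (X ^ 2 - C (w k ^ 2)) := by
  simp_rw [quad_eq_mul_conj]
  rw [Finset.prod_mul_distrib]
  have hconj : ∏ k ∈ s, (X - C (conj (w k))) = ∏ k ∈ s, (X + C (w k)) := by
    refine Finset.prod_nbij' σ σ hσs hσs hσσ hσσ fun k hk => ?_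
    rw [hw k hk, map_neg, ← sub_eq_add_neg]
  rw [hconj, ← Finset.prod_mul_distrib]
  refine Finset.prod_congr rfl fun k _ => ?_
  rw [map_pow]; ring

/-- **Lüscher's factorisation (3.5) of the complexified `P_{n,ε}` composed with the square**:
`P(X²) = c_n ∏_{k=1}^{n} [(X − μ_k)² + ν_k²]` for even `n` ("the polynomial may then be written in the
manifestly positive form"; Bunk et al. (8): "`P(Q²) = constant × ∏ₖ[(Q − μ_k)² + ν_k²]`").
[cite: Luscher1994, §3 eq. (3.5)] [cite: BunkEtAl1995, §2 eqs. (8)–(9)] -/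
theorem map_invPoly_comp_X_sq (hε : 0 < ε) (hε1 : ε < 1) (hn : Even n) :
    ((invPoly ε n).map (algebraMap ℝ ℂ)).comp (X ^ 2) =
      C (((invPoly ε n).leadingCoeff : ℝ) : ℂ) *
        ∏ k ∈ Finset.Icc 1 n, ((X - C (rootMu ε n k : ℂ)) ^ 2 + C ((rootNu ε n k : ℂ) ^ 2)) := by
  rw [map_invPoly_eq_prod hε hε1 n, mul_comp, C_comp, Polynomial.prod_comp]
  simp only [sub_comp, X_comp, C_comp]
  congr 1
  have h := prod_quad_eq_prod_sq_sub (Finset.Icc 1 n) (fun k => usqrt (root ε n k))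
    (fun k => n + 1 - k) (fun k hk => by rw [Finset.mem_Icc] at hk ⊢; omega)
    (fun k hk => by rw [Finset.mem_Icc] at hk; omega)
    (fun k hk => by
      rw [Finset.mem_Icc] at hk
      rw [← usqrt_conj (root_im_ne_zero hε hn hk.1 hk.2), conj_root ε (by omega)])
  simp only [usqrt_sq] at h
  rw [← h]
  rfl

end Factorisation

/-! ## §4 The bosonised determinant: `det P(Q²) = c_nᴺ ∏ₖ det[(Q − μ_k)² + ν_k²] > 0` and its Gaussian
representation (Lüscher (3.3), (3.7)–(3.9); Bunk et al. (10)–(12); Boriçi–de Forcrand (2)–(3);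
Frezzotti–Jansen (5)–(6)) -/

section Matrices

open Matrix MeasureTheory ComplexConjugate Literature.Analysis.SpecialFunctions
open scoped MatrixOrder ComplexOrder BigOperators

variable {ι : Type} [Fintype ι] [DecidableEq ι] {ε : ℝ}

/-- The complexified polynomial `P_{n,ε} ∈ ℂ[X]` (to be evaluated on complex matrices `Q²`).
[cite: BoriciDeforcrand1995, §2 eqs. (1)–(2)] -/
abbrev invPolyC (ε : ℝ) (n : ℕ) : ℂ[X] := (invPoly ε n).map (algebraMap ℝ ℂ)

/-- **One multiboson factor** `(Q − μ)² + ν²` for a square complex matrix `Q` and reals `μ, ν`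
(the kernel of the local, non-negative bosonic action `|(Q − μ_k)φ_k|² + ν_k²|φ_k|²`).
[cite: Luscher1994, §3 eqs. (3.5), (3.7)] [cite: BunkEtAl1995, §2 eqs. (8), (10), (12)] -/
def quadFactor (Q : Matrix ι ι ℂ) (μ ν : ℝ) : Matrix ι ι ℂ :=
  (Q - (μ : ℂ) • (1 : Matrix ι ι ℂ)) ^ 2 + ((ν : ℂ) ^ 2) • (1 : Matrix ι ι ℂ)

/-- Unfolding `(Q − μ)² + ν²`. [cite: Luscher1994, §3 eq. (3.5)] -/
theorem quadFactor_def (Q : Matrix ι ι ℂ) (μ ν : ℝ) :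
    quadFactor Q μ ν = (Q - (μ : ℂ) • (1 : Matrix ι ι ℂ)) ^ 2 + ((ν : ℂ) ^ 2) • (1 : Matrix ι ι ℂ) := rfl

/-- `(Q − μ)² + ν² = p(Q)` for the polynomial `p = (X − μ)² + ν²`. [cite: Luscher1994, §3 eq. (3.5)] -/
theorem aeval_quad (Q : Matrix ι ι ℂ) (μ ν : ℝ) :
    aeval Q ((X - C (μ : ℂ)) ^ 2 + C ((ν : ℂ) ^ 2)) = quadFactor Q μ ν := by
  simp only [map_add, map_pow, map_sub, aeval_X, aeval_C, Algebra.algebraMap_eq_smul_one, quadFactor,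
    _root_.smul_pow, one_pow]

/-- For a Hermitian matrix `H` and `Im w ≠ 0`, `det(H − w·1) ≠ 0` — the spectrum of a Hermitian matrix
is real ("One only requires … that none of the roots `z_k` of the polynomial are real"; the general lemma
is also in the tree's `Multiboson.lean`, re-proved here privately to keep imports small). [folklore] -/
private theorem det_sub_smul_ne_zero {H : Matrix ι ι ℂ} (hH : H.IsHermitian) {w : ℂ} (hw : w.im ≠ 0) :
    (H - w • (1 : Matrix ι ι ℂ)).det ≠ 0 := by
  have h1 : H - w • (1 : Matrix ι ι ℂ) = -(Matrix.scalar ι w - H) := by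
    rw [Matrix.scalar_apply, ← Matrix.smul_one_eq_diagonal, neg_sub]
  rw [h1, Matrix.det_neg, ← Matrix.eval_charpoly, hH.charpoly_eq, Polynomial.eval_prod]
  refine mul_ne_zero (pow_ne_zero _ (neg_ne_zero.mpr one_ne_zero)) ?_
  refine Finset.prod_ne_zero_iff.mpr fun i _ h => hw ?_
  have him := congrArg Complex.im h
  simpa using him

/-- **Lüscher's rewriting of one factor**: for HERMITIAN `Q` and `w = μ + iν`,
`(Q − μ)² + ν² = (Q − w)†(Q − w)` — so `φ†[(Q − μ)² + ν²]φ = |(Q − μ − iν)φ|² ≥ 0`, "the action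
`S_b[U,φ]` is local and non-negative". [cite: Luscher1994, §3 eqs. (3.5)–(3.7)] [cite: BoriciDeforcrand1995,
§2 eqs. (2)–(3)] -/
theorem quadFactor_eq_conjTranspose_mul {Q : Matrix ι ι ℂ} (hQ : Q.IsHermitian) (μ ν : ℝ) :
    quadFactor Q μ ν =
      (Q - ((μ : ℂ) + (ν : ℂ) * Complex.I) • (1 : Matrix ι ι ℂ))ᴴ *
        (Q - ((μ : ℂ) + (ν : ℂ) * Complex.I) • (1 : Matrix ι ι ℂ)) := by
  set w : ℂ := (μ : ℂ) + (ν : ℂ) * Complex.I with hw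
  have hre : w.re = μ := by simp [hw]
  have him : w.im = ν := by simp [hw]
  have hct : (Q - w • (1 : Matrix ι ι ℂ))ᴴ = Q - (conj w) • (1 : Matrix ι ι ℂ) := by
    rw [conjTranspose_sub, hQ.eq, conjTranspose_smul, conjTranspose_one, Complex.star_def]
  rw [hct, ← aeval_quad, ← hre, ← him, quad_eq_mul_conj, mul_comm, map_mul]
  simp only [map_sub, aeval_X, aeval_C, Algebra.algebraMap_eq_smul_one]

/-- The quadratic form of one factor is a sum of squares: `Re φ†[(Q − μ)² + ν²]φ = Σᵢ |((Q − w)φ)ᵢ|²`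
(Hermitian `Q`, `w = μ + iν`). [cite: Luscher1994, §3 eq. (3.7)] [cite: BunkEtAl1995, §2 eq. (12)] -/
theorem re_quadForm_quadFactor {Q : Matrix ι ι ℂ} (hQ : Q.IsHermitian) (μ ν : ℝ) (φ : ι → ℂ) :
    (star φ ⬝ᵥ quadFactor Q μ ν *ᵥ φ).re =
      ∑ i, ‖((Q - ((μ : ℂ) + (ν : ℂ) * Complex.I) • (1 : Matrix ι ι ℂ)) *ᵥ φ) i‖ ^ 2 := by
  rw [quadFactor_eq_conjTranspose_mul hQ]
  exact re_star_dotProduct_conjTranspose_mul_self_mulVec _ φ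

/-- **Each factor is positive definite** (Hermitian `Q`, `ν ≠ 0`): "In particular, the Gaussian integrals
in eq. (3.8) are well-defined" — `Q − μ − iν` is invertible because `Q` has real spectrum.
[cite: Luscher1994, §3 (after eq. (3.9))] -/
theorem posDef_quadFactor {Q : Matrix ι ι ℂ} (hQ : Q.IsHermitian) (μ : ℝ) {ν : ℝ} (hν : ν ≠ 0) :
    (quadFactor Q μ ν).PosDef := by
  rw [quadFactor_eq_conjTranspose_mul hQ]
  have hdet : (Q - ((μ : ℂ) + (ν : ℂ) * Complex.I) • (1 : Matrix ι ι ℂ)).det ≠ 0 :=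
    det_sub_smul_ne_zero hQ (by simp [hν])
  have hunit : IsUnit (Q - ((μ : ℂ) + (ν : ℂ) * Complex.I) • (1 : Matrix ι ι ℂ)) :=
    (Matrix.isUnit_iff_isUnit_det _).mpr (isUnit_iff_ne_zero.mpr hdet)
  exact Matrix.PosDef.conjTranspose_mul_self _ (Matrix.mulVec_injective_of_isUnit hunit)

/-- **`det[(Q − μ)² + ν²] = |det(Q − μ − iν)|²`** (Hermitian `Q`) — one factor of Boriçi–de Forcrand's
`det(Q − √z̄_k) det(Q − √z_k)`. [cite: BoriciDeforcrand1995, §2 eq. (2)] [cite: Luscher1994, §3 eq. (3.5)] -/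
theorem det_quadFactor {Q : Matrix ι ι ℂ} (hQ : Q.IsHermitian) (μ ν : ℝ) :
    (quadFactor Q μ ν).det =
      ((‖(Q - ((μ : ℂ) + (ν : ℂ) * Complex.I) • (1 : Matrix ι ι ℂ)).det‖ ^ 2 : ℝ) : ℂ) := by
  rw [quadFactor_eq_conjTranspose_mul hQ, det_mul, det_conjTranspose, Complex.star_def, Complex.conj_mul']
  norm_cast

/-- `det[(Q − μ)² + ν²] > 0` for Hermitian `Q` and `ν ≠ 0`. [cite: Luscher1994, §3 (after eq. (3.9))] -/
theorem det_quadFactor_pos {Q : Matrix ι ι ℂ} (hQ : Q.IsHermitian) (μ : ℝ) {ν : ℝ} (hν : ν ≠ 0) :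
    0 < ((quadFactor Q μ ν).det).re := by
  rw [det_quadFactor hQ, Complex.ofReal_re]
  exact pow_pos (norm_pos_iff.mpr (det_sub_smul_ne_zero hQ (by simp [hν]))) 2

/-- **One root = one boson field** (Bunk et al. (10): "`det[(Q − μ_k)² + ν_k²]⁻¹` can be represented as
a Gaussian integral over some auxiliary bosonic field `φ_k`"; Boriçi–de Forcrand (3)): for Hermitian `Q`
and `ν ≠ 0`,
`∫_{ℂᴺ} exp(−φ†[(Q − μ)² + ν²]φ) ∏ dRe φᵢ dIm φᵢ = πᴺ / |det(Q − μ − iν)|² = πᴺ / det[(Q − μ)² + ν²]`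
(the tree's discharged complex Gaussian integral, Altland–Simons (3.17)).
[cite: BunkEtAl1995, §2 eq. (10)] [cite: BoriciDeforcrand1995, §2 eq. (3)] [cite: Luscher1994, §3 eqs. (3.8)–(3.9)] -/
theorem integral_exp_neg_quadForm_quadFactor {Q : Matrix ι ι ℂ} (hQ : Q.IsHermitian) (μ : ℝ) {ν : ℝ}
    (hν : ν ≠ 0) :
    ∫ φ : ι → ℂ, Real.exp (-(star φ ⬝ᵥ quadFactor Q μ ν *ᵥ φ).re) =
      Real.pi ^ Fintype.card ι / ‖(Q - ((μ : ℂ) + (ν : ℂ) * Complex.I) • (1 : Matrix ι ι ℂ)).det‖ ^ 2 := by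
  simp_rw [re_quadForm_quadFactor hQ]
  exact complexGaussianIntegral_normSq_of complexGaussianIntegral_posDef_holds ι _
    (det_sub_smul_ne_zero hQ (by simp [hν]))

/-- The same integral with the determinant of the factor itself in the denominator.
[cite: BunkEtAl1995, §2 eq. (10)] -/
theorem integral_exp_neg_quadForm_quadFactor' {Q : Matrix ι ι ℂ} (hQ : Q.IsHermitian) (μ : ℝ) {ν : ℝ}
    (hν : ν ≠ 0) :
    ∫ φ : ι → ℂ, Real.exp (-(star φ ⬝ᵥ quadFactor Q μ ν *ᵥ φ).re) =
      Real.pi ^ Fintype.card ι / ((quadFactor Q μ ν).det).re := by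
  rw [integral_exp_neg_quadForm_quadFactor hQ μ hν, det_quadFactor hQ, Complex.ofReal_re]

/-- The determinant of a product of polynomials in one matrix is the product of the determinants
(private helper). [folklore] -/
private theorem det_aeval_prod {κ : Type*} (Q : Matrix ι ι ℂ) (s : Finset κ) (f : κ → ℂ[X]) :
    (aeval Q (∏ k ∈ s, f k)).det = ∏ k ∈ s, (aeval Q (f k)).det := by
  induction s using Finset.cons_induction with
  | empty => simp
  | cons a s has ih => rw [Finset.prod_cons, map_mul, det_mul, ih, Finset.prod_cons]

/-- `P(Q²) = P ∘ X²` evaluated at `Q` (private helper). [folklore] -/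
private theorem aeval_mul_self_eq (ε : ℝ) (n : ℕ) (Q : Matrix ι ι ℂ) :
    aeval (Q * Q) (invPolyC ε n) = aeval Q ((invPolyC ε n).comp (X ^ 2)) := by
  rw [Polynomial.aeval_comp, map_pow, aeval_X, sq]

/-- **`det P(Q²) = c_nᴺ ∏_{k=1}^{n} det[(Q − μ_k)² + ν_k²]`** for ANY square complex matrix `Q` and
even `n` (Lüscher's (3.5) under the determinant; Boriçi–de Forcrand (2) with Lüscher's branch of the
square roots). [cite: Luscher1994, §3 eqs. (3.3), (3.5)] [cite: BoriciDeforcrand1995, §2 eq. (2)] -/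
theorem det_aeval_invPoly (hε : 0 < ε) (hε1 : ε < 1) {n : ℕ} (hn : Even n) (Q : Matrix ι ι ℂ) :
    (aeval (Q * Q) (invPolyC ε n)).det =
      (((invPoly ε n).leadingCoeff : ℝ) : ℂ) ^ Fintype.card ι *
        ∏ k ∈ Finset.Icc 1 n, (quadFactor Q (rootMu ε n k) (rootNu ε n k)).det := by
  rw [aeval_mul_self_eq, invPolyC, map_invPoly_comp_X_sq hε hε1 hn, map_mul, aeval_C,
    Algebra.algebraMap_eq_smul_one, smul_mul_assoc, one_mul, det_smul, det_aeval_prod]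
  simp_rw [aeval_quad]

variable {Q : Matrix ι ι ℂ}

/-- **`det P(Q²)` is real and positive** for Hermitian `Q` and even `n`: every factor is
`|det(Q − μ_k − iν_k)|² > 0` and `c_n > 0`. [cite: Luscher1994, §3 eqs. (3.3), (3.5) and the remark
after (3.9)] [cite: BoriciDeforcrand1995, §2 eq. (2)] -/
theorem det_aeval_invPoly_eq_ofReal (hε : 0 < ε) (hε1 : ε < 1) {n : ℕ} (hn : Even n)
    (hQ : Q.IsHermitian) :
    (aeval (Q * Q) (invPolyC ε n)).det =
      (((invPoly ε n).leadingCoeff ^ Fintype.card ι *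
        ∏ k ∈ Finset.Icc 1 n,
          ‖(Q - ((rootMu ε n k : ℂ) + (rootNu ε n k : ℂ) * Complex.I) • (1 : Matrix ι ι ℂ)).det‖ ^ 2 :
          ℝ) : ℂ) := by
  rw [det_aeval_invPoly hε hε1 hn]
  simp_rw [det_quadFactor hQ]
  push_cast
  rfl

/-- Positivity of `det P(Q²)` (Hermitian `Q`, even `n`). [cite: Luscher1994, §3 (after eq. (3.9))] -/
theorem det_aeval_invPoly_pos (hε : 0 < ε) (hε1 : ε < 1) {n : ℕ} (hn : Even n) (hQ : Q.IsHermitian) :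
    0 < ((aeval (Q * Q) (invPolyC ε n)).det).re := by
  rw [det_aeval_invPoly_eq_ofReal hε hε1 hn hQ, Complex.ofReal_re]
  refine mul_pos (pow_pos (leadingCoeff_invPoly_pos hε hε1 hn) _) (Finset.prod_pos fun k hk => ?_)
  rw [Finset.mem_Icc] at hk
  exact pow_pos (norm_pos_iff.mpr (det_sub_smul_ne_zero hQ
    (by simpa using (rootNu_pos hε hn hk.1 hk.2).ne'))) 2

/-- **The multiboson representation of `1/det P(Q²)`** (Lüscher (3.8)–(3.9) "`P_eff[U] = lim 1/Z_b ∫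
D[φ]D[φ†] e^{−S_b[U,φ]}`", Bunk et al. (11)–(12), Frezzotti–Jansen (6), Boriçi–de Forcrand (3):
"`det Q² ≈ 1/det P(Q²) = … ∫∏ₖ[dφ_k†][dφ_k] e^{−φ_k†(Q − √z_k)†(Q − √z_k)φ_k}`"): for Hermitian `Q` and
even `n`,
`1/det P(Q²) = c_n^{−N} ∏_{k=1}^{n} ( π^{−N} ∫_{ℂᴺ} exp(−φ_k†[(Q − μ_k)² + ν_k²]φ_k) dφ_k )`.
[cite: Luscher1994, §3 eqs. (3.8)–(3.9)] [cite: BunkEtAl1995, §2 eqs. (10)–(12)]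
[cite: BoriciDeforcrand1995, §2 eq. (3)] [cite: FrezzottiJansen1997, eqs. (5)–(6)] -/
theorem inv_det_aeval_invPoly_eq_prod_integral (hε : 0 < ε) (hε1 : ε < 1) {n : ℕ} (hn : Even n)
    (hQ : Q.IsHermitian) :
    (((aeval (Q * Q) (invPolyC ε n)).det).re)⁻¹ =
      ((invPoly ε n).leadingCoeff ^ Fintype.card ι)⁻¹ *
        ∏ k ∈ Finset.Icc 1 n, ((Real.pi ^ Fintype.card ι)⁻¹ *
          ∫ φ : ι → ℂ, Real.exp (-(star φ ⬝ᵥ quadFactor Q (rootMu ε n k) (rootNu ε n k) *ᵥ φ).re)) := by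
  rw [det_aeval_invPoly_eq_ofReal hε hε1 hn hQ, Complex.ofReal_re, mul_inv, ← Finset.prod_inv_distrib]
  congr 1
  refine Finset.prod_congr rfl fun k hk => ?_
  rw [Finset.mem_Icc] at hk
  rw [integral_exp_neg_quadForm_quadFactor hQ _ (rootNu_pos hε hn hk.1 hk.2).ne']
  have hpi : (Real.pi ^ Fintype.card ι : ℝ) ≠ 0 := pow_ne_zero _ Real.pi_pos.ne'
  field_simp

end Matrices

/-! ## §5 The exact correction factor `W = det[Q² P(Q²)]` (Frezzotti–Jansen (4)–(8); Boriçi–de Forcrand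
(13)–(14) and §6; Lüscher §4 "After replacing `det Q²` by `[det P(Q²)]⁻¹` …") -/

section CorrectionFactor

open Matrix MeasureTheory ComplexConjugate Literature.Analysis.SpecialFunctions
open Literature.MathematicalPhysics.QuantumLattice
open scoped MatrixOrder ComplexOrder BigOperators

variable {ι : Type} [Fintype ι] [DecidableEq ι] {ε : ℝ} {n : ℕ} {Q : Matrix ι ι ℂ}

/-- **The correction factor** `W(Q) = det[Q² P_{n,ε}(Q²)]` — Boriçi–de Forcrand's `y ≡ det Q²P(Q²)`
((13)), the quantity whose Gaussian-noise estimate is Frezzotti–Jansen's `W` ((7)): including it (by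
reweighting `⟨O⟩ = ⟨OW⟩_P/⟨W⟩_P` or by an accept/reject step) makes the polynomial algorithm exact,
omitting it samples `e^{−S_g}/det P(Q²)` instead of `e^{−S_g} det Q²`.
[cite: BoriciDeforcrand1995, §2 eq. (13)] [cite: FrezzottiJansen1997, eqs. (5)–(8)] -/
def corrFactor (ε : ℝ) (n : ℕ) (Q : Matrix ι ι ℂ) : ℂ := (Q * Q * aeval (Q * Q) (invPolyC ε n)).det

/-- Unfolding `W = det[Q²P(Q²)]`. [cite: BoriciDeforcrand1995, §2 eq. (13)] -/
theorem corrFactor_def (ε : ℝ) (n : ℕ) (Q : Matrix ι ι ℂ) :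
    corrFactor ε n Q = (Q * Q * aeval (Q * Q) (invPolyC ε n)).det := rfl

/-- `W = det(Q²) · det P(Q²)`. [cite: FrezzottiJansen1997, eq. (5)] -/
theorem corrFactor_eq_det_mul (ε : ℝ) (n : ℕ) (Q : Matrix ι ι ℂ) :
    corrFactor ε n Q = (Q * Q).det * (aeval (Q * Q) (invPolyC ε n)).det := by
  rw [corrFactor, det_mul]

/-- **Frezzotti–Jansen's exact rewriting (5)**: `det(Q²) = det[Q²P_n(Q²)] / det[P_n(Q²)]` whenever
`det P_n(Q²) ≠ 0` (e.g. Hermitian `Q`, even `n`: `det_aeval_invPoly_pos`) — "Note that eq. (newpf) is an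
exact rewriting of the partition function". [cite: FrezzottiJansen1997, eqs. (5)–(6)] -/
theorem det_mul_self_eq_corrFactor_div (ε : ℝ) (n : ℕ) (Q : Matrix ι ι ℂ)
    (hP : (aeval (Q * Q) (invPolyC ε n)).det ≠ 0) :
    (Q * Q).det = corrFactor ε n Q / (aeval (Q * Q) (invPolyC ε n)).det := by
  rw [corrFactor_eq_det_mul, mul_div_cancel_right₀ _ hP]

/-- **An exact zero mode kills the corrected weight**: `det Q = 0 ⇒ W = 0` (Frezzotti–Jansen: the
algorithm "offers the possibility to detect the appearance of eventual zero modes and to control their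
effects" — the uncorrected weight `1/det P(Q²)` stays finite, `P(0) = O(1/ε)`, while `W` carries the
zero). [cite: FrezzottiJansen1997, p. 1 (abstract) and the remark "For 0 ≤ s ≤ ε the polynomial … is
always finite with values O(1/ε)"] -/
theorem corrFactor_eq_zero_of_det_eq_zero (ε : ℝ) (n : ℕ) (hQ : Q.det = 0) : corrFactor ε n Q = 0 := by
  rw [corrFactor_eq_det_mul, det_mul, hQ, zero_mul, zero_mul]

/-- `Q²` is Hermitian for Hermitian `Q` (private helper). [folklore] -/
private theorem isHermitian_mul_self (hQ : Q.IsHermitian) : (Q * Q).IsHermitian := by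
  simpa [sq] using hQ.pow 2

omit [DecidableEq ι] in
/-- `Q²` is positive semidefinite for Hermitian `Q` (private helper). [folklore] -/
private theorem posSemidef_mul_self (hQ : Q.IsHermitian) : (Q * Q).PosSemidef := by
  simpa [hQ.eq] using Matrix.posSemidef_conjTranspose_mul_self Q

/-- **`Q²P(Q²)` is the function `s ↦ sP(s) = 1 − R(s)` of the Hermitian matrix `Q²`** (continuous
functional calculus = polynomial calculus). [cite: BoriciDeforcrand1995, §2 eqs. (13)–(14)] -/
theorem mul_self_mul_aeval_eq_cfc (hQ : Q.IsHermitian) (ε : ℝ) (n : ℕ) :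
    Q * Q * aeval (Q * Q) (invPolyC ε n) =
      cfc (fun s : ℝ => s * (invPoly ε n).eval s) (Q * Q) := by
  have hA : IsSelfAdjoint (Q * Q) := (isHermitian_mul_self hQ).isSelfAdjoint
  have h1 : Q * Q * aeval (Q * Q) (invPolyC ε n) = aeval (Q * Q) (X * invPoly ε n) := by
    rw [map_mul, aeval_X, invPolyC, Polynomial.aeval_map_algebraMap]
  rw [h1, ← cfc_polynomial (X * invPoly ε n) (Q * Q) hA]
  congr 1
  funext s
  simp only [eval_mul, eval_X]

/-- **Boriçi–de Forcrand (14)**: `W = ∏ᵢ λᵢ P(λᵢ)` over the eigenvalues `λᵢ` of `Q²` (Hermitian `Q`).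
[cite: BoriciDeforcrand1995, §2 eqs. (13)–(14)] -/
theorem corrFactor_eq_prod_eigenvalues (hQ : Q.IsHermitian) (ε : ℝ) (n : ℕ) :
    corrFactor ε n Q =
      ∏ i, (((isHermitian_mul_self hQ).eigenvalues i * (invPoly ε n).eval
        ((isHermitian_mul_self hQ).eigenvalues i) : ℝ) : ℂ) := by
  rw [corrFactor, mul_self_mul_aeval_eq_cfc hQ, RHMC.det_cfc (isHermitian_mul_self hQ)]

/-- The same product written with the error polynomial: `W = ∏ᵢ (1 − R(λᵢ))`.
[cite: BoriciDeforcrand1995, §2 eqs. (12)–(14)] [cite: FrezzottiJansen1997, eqs. (7), (11)] -/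
theorem corrFactor_eq_prod_one_sub (hQ : Q.IsHermitian) (hε : 0 < ε) (hε1 : ε < 1) (n : ℕ) :
    corrFactor ε n Q =
      ∏ i, ((1 - (errPoly ε n).eval ((isHermitian_mul_self hQ).eigenvalues i) : ℝ) : ℂ) := by
  rw [corrFactor_eq_prod_eigenvalues hQ]
  simp_rw [mul_eval_invPoly hε hε1]

/-- `W` is real for Hermitian `Q`. [cite: BoriciDeforcrand1995, §2 eq. (14)] -/
theorem corrFactor_im (hQ : Q.IsHermitian) (ε : ℝ) (n : ℕ) : (corrFactor ε n Q).im = 0 := by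
  rw [corrFactor_eq_prod_eigenvalues hQ, ← Complex.ofReal_prod, Complex.ofReal_im]

/-- Below the cut-off the factor `sP(s) = 1 − R(s)` is `< 1`: for `s ≤ ε` the Chebyshev argument is
`≥ 1`, where `T_{n+1} ≥ 1`, so `R(s) ≥ 1/T_{n+1}((1+ε)/(1−ε)) > 0` (the low modes are damped, never
amplified, by the uncorrected weight). [cite: FrezzottiJansen1997, remark "For 0 ≤ s ≤ ε the polynomial
P_{[n,ε]}(s) is always finite with values O(1/ε)"] [cite: Luscher1994, §4.3 eq. (4.20) and the sentence
after (4.19)] -/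
theorem mul_eval_invPoly_lt_one (hε : 0 < ε) (hε1 : ε < 1) (n : ℕ) {s : ℝ} (hs : s ≤ ε) :
    s * (invPoly ε n).eval s < 1 := by
  rw [mul_eval_invPoly hε hε1, sub_lt_self_iff, eval_errPoly]
  refine mul_pos (inv_pos.mpr (eval_T_ratio_pos hε hε1 (n + 1))) ?_
  refine lt_of_lt_of_le zero_lt_one (Polynomial.Chebyshev.one_le_eval_T_real _ ?_)
  have h3 : (0 : ℝ) < 1 - ε := by linarith
  rw [show (1 + ε) / (1 - ε) - 2 / (1 - ε) * s = (1 + ε - 2 * s) / (1 - ε) by field_simp,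
    le_div_iff₀ h3]
  linarith

/-- For even `n` and `s ≥ 0`: `0 ≤ sP(s)` (since `P > 0`). [cite: FrezzottiJansen1997, (after eq. (4)):
"P_n(λ(Q²)) > 0 for all the eigenvalues"] -/
theorem mul_eval_invPoly_nonneg (hε : 0 < ε) (hε1 : ε < 1) (hn : Even n) {s : ℝ} (hs : 0 ≤ s) :
    0 ≤ s * (invPoly ε n).eval s :=
  mul_nonneg hs (eval_invPoly_pos hε hε1 hn s).le

/-- **`W > 0` when the spectrum of `Q²` lies in the fit range `[ε, 1]`** (every factor
`λᵢP(λᵢ) = 1 − R(λᵢ) ≥ 1 − 1/cosh((n+1)β) > 0`). [cite: BoriciDeforcrand1995, §2 eqs. (12)–(14)] -/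
theorem corrFactor_re_pos_of_spectrum (hQ : Q.IsHermitian) (hε : 0 < ε) (hε1 : ε < 1) (n : ℕ)
    (hspec : ∀ x ∈ spectrum ℝ (Q * Q), ε ≤ x ∧ x ≤ 1) : 0 < (corrFactor ε n Q).re := by
  have hA := isHermitian_mul_self hQ
  rw [corrFactor_eq_prod_eigenvalues hQ, ← Complex.ofReal_prod, Complex.ofReal_re]
  exact Finset.prod_pos fun i _ =>
    mul_eval_invPoly_pos_of_mem hε hε1 n (hspec _ (hA.eigenvalues_mem_spectrum_real i))

/-- **The size of the correction when the spectrum of `Q²` lies in the fit range `[ε, 1]`, upper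
side**: `W ≤ (1 + δ)ᴺ`, `N = dim` — every factor `λᵢP(λᵢ) = 1 − R(λᵢ)` is within `δ` of `1`
(Boriçi–de Forcrand's error measure `|y^{1/N} − 1|`; the cell's reading: a polynomial approximation LEFT
in the accept step tilts the target by exactly `W(U)` per configuration, cf. HOME/R2-SCOPE §3 E4).
[cite: BoriciDeforcrand1995, §2 eqs. (12)–(14) and §3 ("|y^{1/N} − 1|")] [cite: FrezzottiJansen1997,
eqs. (7), (11)–(13)] -/
theorem corrFactor_re_le_of_spectrum (hQ : Q.IsHermitian) (hε : 0 < ε) (hε1 : ε < 1) (n : ℕ)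
    (hspec : ∀ x ∈ spectrum ℝ (Q * Q), ε ≤ x ∧ x ≤ 1) :
    (corrFactor ε n Q).re ≤ (1 + delta ε n) ^ Fintype.card ι := by
  have hA := isHermitian_mul_self hQ
  have hev : ∀ i, ε ≤ hA.eigenvalues i ∧ hA.eigenvalues i ≤ 1 := fun i =>
    hspec _ (hA.eigenvalues_mem_spectrum_real i)
  rw [corrFactor_eq_prod_eigenvalues hQ, ← Complex.ofReal_prod, Complex.ofReal_re, ← Finset.card_univ,
    ← Finset.prod_const]
  exact Finset.prod_le_prod (fun i _ => (mul_eval_invPoly_pos_of_mem hε hε1 n (hev i)).le)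
    fun i _ => (mul_eval_invPoly_mem_Icc hε hε1 n (hev i)).2

/-- **Lower side**: `(1 − δ)ᴺ ≤ W` when the spectrum of `Q²` lies in `[ε, 1]` and `δ ≤ 1`.
[cite: BoriciDeforcrand1995, §2 eqs. (12)–(14)] [cite: FrezzottiJansen1997, eqs. (7), (11)–(13)] -/
theorem pow_le_corrFactor_re_of_spectrum (hQ : Q.IsHermitian) (hε : 0 < ε) (hε1 : ε < 1) (n : ℕ)
    (hspec : ∀ x ∈ spectrum ℝ (Q * Q), ε ≤ x ∧ x ≤ 1) (hδ : delta ε n ≤ 1) :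
    (1 - delta ε n) ^ Fintype.card ι ≤ (corrFactor ε n Q).re := by
  have hA := isHermitian_mul_self hQ
  have hev : ∀ i, ε ≤ hA.eigenvalues i ∧ hA.eigenvalues i ≤ 1 := fun i =>
    hspec _ (hA.eigenvalues_mem_spectrum_real i)
  rw [corrFactor_eq_prod_eigenvalues hQ, ← Complex.ofReal_prod, Complex.ofReal_re, ← Finset.card_univ,
    ← Finset.prod_const]
  exact Finset.prod_le_prod (fun i _ => by linarith) fun i _ => (mul_eval_invPoly_mem_Icc hε hε1 n (hev i)).1

/-- **`W ≥ 0` for even `n`, whatever the spectrum** (`Q²` has eigenvalues `λᵢ ≥ 0` and `P > 0`).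
[cite: FrezzottiJansen1997, (after eq. (4)): "P_n(λ(Q²)) > 0 for all the eigenvalues λ(Q²) of Q² in
the range 0 ≤ λ(Q²) < 1"] -/
theorem corrFactor_re_nonneg (hQ : Q.IsHermitian) (hε : 0 < ε) (hε1 : ε < 1) (hn : Even n) :
    0 ≤ (corrFactor ε n Q).re := by
  have hA := isHermitian_mul_self hQ
  rw [corrFactor_eq_prod_eigenvalues hQ, ← Complex.ofReal_prod, Complex.ofReal_re]
  exact Finset.prod_nonneg fun i _ =>
    mul_eval_invPoly_nonneg hε hε1 hn ((posSemidef_mul_self hQ).eigenvalues_nonneg i)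

/-- **`W ≤ (1 + δ)ᴺ` for even `n` as soon as `‖Q‖ ≤ 1`** (spectrum of `Q²` in `[0, 1]`; the modes
below `ε` contribute factors in `[0, 1)`): Frezzotti–Jansen's setting "`c_M` should be chosen such that
the eigenvalues `λ` of `Q` satisfy `|λ| < 1`" with `ε > λ_min(Q²)` allowed.
[cite: FrezzottiJansen1997, eq. (3) (c_M) and the remark "one might choose ε > λ_min(Q²)"] -/
theorem corrFactor_re_le (hQ : Q.IsHermitian) (hε : 0 < ε) (hε1 : ε < 1) (hn : Even n)
    (hspec : ∀ x ∈ spectrum ℝ (Q * Q), x ≤ 1) :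
    (corrFactor ε n Q).re ≤ (1 + delta ε n) ^ Fintype.card ι := by
  have hA := isHermitian_mul_self hQ
  have hev : ∀ i, 0 ≤ hA.eigenvalues i ∧ hA.eigenvalues i ≤ 1 := fun i =>
    ⟨(posSemidef_mul_self hQ).eigenvalues_nonneg i, hspec _ (hA.eigenvalues_mem_spectrum_real i)⟩
  rw [corrFactor_eq_prod_eigenvalues hQ, ← Complex.ofReal_prod, Complex.ofReal_re, ← Finset.card_univ,
    ← Finset.prod_const]
  refine Finset.prod_le_prod (fun i _ => mul_eval_invPoly_nonneg hε hε1 hn (hev i).1) fun i _ => ?_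
  rcases le_or_gt (hA.eigenvalues i) ε with hle | hgt
  · exact (mul_eval_invPoly_lt_one hε hε1 n hle).le.trans (by linarith [delta_pos hε hε1 n])
  · exact (mul_eval_invPoly_mem_Icc hε hε1 n ⟨hgt.le, (hev i).2⟩).2

/-- `cfc` of the reciprocal kernel is the matrix inverse of `Q²P(Q²)` (private helper). [folklore] -/
private theorem cfc_inv_eq (hQ : Q.IsHermitian) (ε : ℝ) (n : ℕ)
    (hpos : ∀ x ∈ spectrum ℝ (Q * Q), 0 < x * (invPoly ε n).eval x) :
    cfc (fun s : ℝ => (s * (invPoly ε n).eval s)⁻¹) (Q * Q) = (Q * Q * aeval (Q * Q) (invPolyC ε n))⁻¹ := by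
  have hA : IsSelfAdjoint (Q * Q) := (isHermitian_mul_self hQ).isSelfAdjoint
  rw [mul_self_mul_aeval_eq_cfc hQ, Matrix.nonsing_inv_eq_ringInverse]
  exact cfc_inv (fun s : ℝ => s * (invPoly ε n).eval s) (Q * Q) (fun x hx => (hpos x hx).ne')
    ((Matrix.finite_real_spectrum (A := Q * Q)).continuousOn _)

/-- **Frezzotti–Jansen's correction factor is an unbiased one-noise estimator of `det[Q²P(Q²)]`**
((6)–(7): "`W = exp{η†(1 − [Q²P_n(Q²)]⁻¹)η}`" integrated against `e^{−η†η}`): for Hermitian invertible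
`Q` and even `n`,
`∫_{ℂᴺ} e^{−η†η} exp{Re η†(1 − [Q²P(Q²)]⁻¹)η} dη = πᴺ · det[Q²P(Q²)]`
(an instance of the tree's Lüscher–Palombi lemma `TwistedMass.integral_rwEstimator`).
[cite: FrezzottiJansen1997, eqs. (6)–(7)] -/
theorem integral_corrEstimator (hQ : Q.IsHermitian) (hdet : Q.det ≠ 0) (hε : 0 < ε) (hε1 : ε < 1)
    (hn : Even n) :
    ∫ η : ι → ℂ, Real.exp (-(star η ⬝ᵥ η).re) *
        Real.exp ((star η ⬝ᵥ (1 - (Q * Q * aeval (Q * Q) (invPolyC ε n))⁻¹) *ᵥ η).re) =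
      Real.pi ^ Fintype.card ι * (corrFactor ε n Q).re := by
  have hA := isHermitian_mul_self hQ
  have hPD : (Q * Q).PosDef := by
    have hunit : IsUnit Q := (Matrix.isUnit_iff_isUnit_det Q).mpr (isUnit_iff_ne_zero.mpr hdet)
    simpa [hQ.eq] using Matrix.PosDef.conjTranspose_mul_self Q (Matrix.mulVec_injective_of_isUnit hunit)
  have hpos : ∀ x ∈ spectrum ℝ (Q * Q), 0 < x * (invPoly ε n).eval x := by
    intro x hx
    rw [hA.spectrum_real_eq_range_eigenvalues] at hx
    obtain ⟨i, rfl⟩ := hx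
    exact mul_pos (hPD.eigenvalues_pos i) (eval_invPoly_pos hε hε1 hn _)
  rw [← cfc_inv_eq hQ ε n hpos, TwistedMass.integral_rwEstimator hA hpos, corrFactor_eq_prod_eigenvalues hQ,
    ← Complex.ofReal_prod, Complex.ofReal_re]

/-- **Boriçi–de Forcrand's Metropolis correction (§6)**: the ratio of errors between new and old
configurations, `[det M'/det M]²`-type quantities with `M = DP(D)`, is estimated WITHOUT BIAS by one
Gaussian vector — "this ratio can be rewritten `⟨e^{−η†(W†W − 1)η}⟩` … `W = [D'P(D')]⁻¹ DP(D)`. It is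
sufficient to estimate this ratio by taking one Gaussian `η` only": for any invertible `M, M'`,
`π^{−N} ∫ e^{−‖η‖²} (e^{−‖Wη‖²}/e^{−‖η‖²}) dη = |det W|⁻² = |det M'|²/|det M|²` (the tree's Knechtli–Wolff
lemma `Pseudofermion.stochasticRatio_mean`; that the resulting N_η = 1 acceptance step is exact is the
tree's `Pseudofermion.integral_min_gaussian_mulVec`). [cite: BoriciDeforcrand1995, §6 eq. (37)] -/
theorem bdf_noisy_ratio (M M' : Matrix ι ι ℂ) (hM : M.det ≠ 0) (hM' : M'.det ≠ 0) :
    (Real.pi ^ Fintype.card ι)⁻¹ * ∫ η : ι → ℂ, Real.exp (-(∑ i, ‖η i‖ ^ 2)) *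
        (Real.exp (-(∑ i, ‖((M'⁻¹ * M) *ᵥ η) i‖ ^ 2)) / Real.exp (-(∑ i, ‖η i‖ ^ 2))) =
      ‖M'.det‖ ^ 2 / ‖M.det‖ ^ 2 := by
  have hW : (M'⁻¹ * M).det ≠ 0 := by
    rw [det_mul, det_nonsing_inv, Ring.inverse_eq_inv']
    exact mul_ne_zero (inv_ne_zero hM') hM
  rw [Pseudofermion.stochasticRatio_mean _ hW, det_mul, det_nonsing_inv, Ring.inverse_eq_inv', norm_mul,
    norm_inv, mul_pow, inv_pow, mul_inv, inv_inv, div_eq_mul_inv, mul_comm]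

end CorrectionFactor

/-! ## §6 The instance: Lüscher's Hermitian quark matrix `Q = c·γ₅(D_W + m)` of the tree's Wilson–Dirac
operator, every gauge field (Lüscher (2.6)–(2.8); Boriçi–de Forcrand (4)–(5); Frezzotti–Jansen (3)) -/

section Wilson

open Matrix MeasureTheory Literature.Probability.LatticeModels Literature.MathematicalPhysics.QuantumLattice
open scoped MatrixOrder ComplexOrder BigOperators

variable {L N : ℕ} [NeZero L] {G : Type*} [Group G] (ρ : G →* Matrix (Fin N) (Fin N) ℂ) {ε : ℝ} {n : ℕ}

/-- **Lüscher's normalised Hermitian quark matrix** `Q = c · γ₅ D_W(U, m, r)` built on the tree's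
gauge-covariant Wilson–Dirac operator `wilsonDirac ρ U m r` (bare mass inside `D_W`), with a real
normalisation `c` (Lüscher (2.7)–(2.8): `Q = γ₅(D + m)/M`, "which has eigenvalues between −1 and 1";
Boriçi–de Forcrand (5): `Q = c₀ γ₅ D`, `c₀ = (1 + 8κ)⁻¹`; Frezzotti–Jansen (3): `c₀ = [c_M(1 + 8κ)]⁻¹`).
[cite: Luscher1994, §2 eqs. (2.6)–(2.8)] [cite: BoriciDeforcrand1995, §2 eqs. (4)–(5)]
[cite: FrezzottiJansen1997, eq. (3)] -/
def wilsonQ (U : GaugeConfig 4 L G) (m r c : ℝ) :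
    Matrix (TorusSite 4 L × Fin N × Fin 4) (TorusSite 4 L × Fin N × Fin 4) ℂ :=
  (c : ℂ) • (spinorLift gammaFive * wilsonDirac ρ U m r)

/-- Unfolding `Q = c·Γ₅D_W`. [cite: Luscher1994, §2 eq. (2.8)] -/
theorem wilsonQ_def (U : GaugeConfig 4 L G) (m r c : ℝ) :
    wilsonQ ρ U m r c = (c : ℂ) • (spinorLift gammaFive * wilsonDirac ρ U m r) := rfl

/-- **`Q` is Hermitian on every gauge field** for a unitary colour representation ("`[γ₅(D + m)]† =
γ₅(D + m)` … the quark determinant `det(D + m)` is real"). [cite: Luscher1994, §2 eqs. (2.6)–(2.8)] -/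
theorem isHermitian_wilsonQ (hρ : ∀ g, ρ g ∈ Matrix.unitaryGroup (Fin N) ℂ) (U : GaugeConfig 4 L G)
    (m r c : ℝ) : (wilsonQ ρ U m r c).IsHermitian := by
  have h := TwistedMass.isHermitian_gammaFive_mul_wilsonDirac ρ hρ U m r
  unfold wilsonQ Matrix.IsHermitian
  rw [conjTranspose_smul, Complex.star_def, Complex.conj_ofReal, h.eq]

/-- **Lüscher's theorem for lattice QCD with two degenerate Wilson flavours, per gauge field**: for even
`n` and `0 < ε < 1`, `det P_{n,ε}(Q(U)²)` is real and strictly positive on EVERY gauge field `U` (so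
`[det P(Q²)]⁻¹ e^{−S_g}` is a positive weight; "the action `S_b[U,φ]` is local and non-negative").
[cite: Luscher1994, §3 eqs. (3.3), (3.5), (3.7)–(3.9)] [cite: BunkEtAl1995, §2 eqs. (7)–(12)] -/
theorem det_aeval_invPoly_wilsonQ_pos (hρ : ∀ g, ρ g ∈ Matrix.unitaryGroup (Fin N) ℂ) (hε : 0 < ε)
    (hε1 : ε < 1) (hn : Even n) (U : GaugeConfig 4 L G) (m r c : ℝ) :
    0 < ((aeval (wilsonQ ρ U m r c * wilsonQ ρ U m r c) (invPolyC ε n)).det).re :=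
  det_aeval_invPoly_pos hε hε1 hn (isHermitian_wilsonQ ρ hρ U m r c)

/-- **The bosonisation of lattice QCD, per gauge field** (Lüscher (3.8)–(3.9): "`P_eff[U] =
lim_{n→∞} Z_b⁻¹ ∫ D[φ]D[φ†] e^{−S_b[U,φ]}`", Bunk et al. (11)–(12), Frezzotti–Jansen (6)): on every gauge
field `U`, `1/det P_{n,ε}(Q(U)²) = c_n^{−N'} ∏_{k=1}^{n} (π^{−N'} ∫ exp(−φ_k†[(Q(U) − μ_k)² + ν_k²]φ_k) dφ_k)`,
`N' = 4N|Λ|` the number of spin-colour-site components.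
[cite: Luscher1994, §3 eqs. (3.7)–(3.9)] [cite: BunkEtAl1995, §2 eqs. (10)–(12)]
[cite: FrezzottiJansen1997, eqs. (5)–(6)] -/
theorem inv_det_aeval_invPoly_wilsonQ (hρ : ∀ g, ρ g ∈ Matrix.unitaryGroup (Fin N) ℂ) (hε : 0 < ε)
    (hε1 : ε < 1) (hn : Even n) (U : GaugeConfig 4 L G) (m r c : ℝ) :
    (((aeval (wilsonQ ρ U m r c * wilsonQ ρ U m r c) (invPolyC ε n)).det).re)⁻¹ =
      ((invPoly ε n).leadingCoeff ^ Fintype.card (TorusSite 4 L × Fin N × Fin 4))⁻¹ *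
        ∏ k ∈ Finset.Icc 1 n, ((Real.pi ^ Fintype.card (TorusSite 4 L × Fin N × Fin 4))⁻¹ *
          ∫ φ : TorusSite 4 L × Fin N × Fin 4 → ℂ,
            Real.exp (-(star φ ⬝ᵥ quadFactor (wilsonQ ρ U m r c) (rootMu ε n k) (rootNu ε n k) *ᵥ φ).re)) :=
  inv_det_aeval_invPoly_eq_prod_integral hε hε1 hn (isHermitian_wilsonQ ρ hρ U m r c)

/-- **The PHMC / multiboson correction factor of a gauge field is a real number in `[0, (1+δ)^{N'}]`**
as soon as the normalisation puts the spectrum of `Q(U)²` in `[0, 1]` (even `n`); it vanishes exactly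
on gauge fields with a zero mode of `D_W`. [cite: FrezzottiJansen1997, eqs. (3), (5)–(8), (13)]
[cite: BoriciDeforcrand1995, §2 eqs. (13)–(14)] -/
theorem corrFactor_wilsonQ_mem_Icc (hρ : ∀ g, ρ g ∈ Matrix.unitaryGroup (Fin N) ℂ) (hε : 0 < ε)
    (hε1 : ε < 1) (hn : Even n) (U : GaugeConfig 4 L G) (m r c : ℝ)
    (hspec : ∀ x ∈ spectrum ℝ (wilsonQ ρ U m r c * wilsonQ ρ U m r c), x ≤ 1) :
    (corrFactor ε n (wilsonQ ρ U m r c)).re ∈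
        Icc 0 ((1 + delta ε n) ^ Fintype.card (TorusSite 4 L × Fin N × Fin 4)) ∧
      (corrFactor ε n (wilsonQ ρ U m r c)).im = 0 :=
  ⟨⟨corrFactor_re_nonneg (isHermitian_wilsonQ ρ hρ U m r c) hε hε1 hn,
    corrFactor_re_le (isHermitian_wilsonQ ρ hρ U m r c) hε hε1 hn hspec⟩,
    corrFactor_im (isHermitian_wilsonQ ρ hρ U m r c) ε n⟩

/-- **With the spectrum of `Q(U)²` inside the fit range `[ε, 1]` the correction is within
`[(1−δ)^{N'}, (1+δ)^{N'}]`** (`δ ≤ 1`) — the per-configuration tilt left by an UNCORRECTED polynomial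
approximation, removed exactly by Frezzotti–Jansen's reweighting / accept step or Boriçi–de Forcrand's
Metropolis test. [cite: FrezzottiJansen1997, eqs. (7)–(8), (11)–(13)] [cite: BoriciDeforcrand1995, §6] -/
theorem corrFactor_wilsonQ_mem_Icc_of_spectrum (hρ : ∀ g, ρ g ∈ Matrix.unitaryGroup (Fin N) ℂ)
    (hε : 0 < ε) (hε1 : ε < 1) (n : ℕ) (U : GaugeConfig 4 L G) (m r c : ℝ)
    (hspec : ∀ x ∈ spectrum ℝ (wilsonQ ρ U m r c * wilsonQ ρ U m r c), ε ≤ x ∧ x ≤ 1)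
    (hδ : delta ε n ≤ 1) :
    (corrFactor ε n (wilsonQ ρ U m r c)).re ∈
      Icc ((1 - delta ε n) ^ Fintype.card (TorusSite 4 L × Fin N × Fin 4))
        ((1 + delta ε n) ^ Fintype.card (TorusSite 4 L × Fin N × Fin 4)) :=
  ⟨pow_le_corrFactor_re_of_spectrum (isHermitian_wilsonQ ρ hρ U m r c) hε hε1 n hspec hδ,
    corrFactor_re_le_of_spectrum (isHermitian_wilsonQ ρ hρ U m r c) hε hε1 n hspec⟩

end Wilson

end Literature.MathematicalPhysics.QuantumFieldTheory.MultibosonPolynomial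

end
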